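import Literature.Barriers.QuantumAdvantage.NoFreeFramePurityBound
import Literature.Computability.QuantumComplexity.PauliParseval
import HarnessLib

/-!
# `symplecticPurityBound` holds: a flat state keeps a low-purity cut in every Clifford frame

Barrier catalogue `Literature/Barriers/QuantumAdvantage/` (D-0021). Proofs only (no definitions, no
named facts): the discharge of the named fact `Literature.Barriers.QuantumAdvantage.symplecticPurityBound`
of `NoFreeFramePurityBound.lean`. Let `ψ` be a unit vector on `n ≥ 1` qubits with `|⟨ψ|σ_S|ψ⟩| ≤ ε`
for every Pauli string `S ≠ I`, and let `U` be a semantic Clifford unitary on `n + m` qubits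
(`U σ_S U† = c σ_{S'}`, `|c| = 1`, for every string `S`). Then some linear cut `{wires < k}` of
`U(ψ ⊗ |0^m⟩)` has purity (four-fold agreement sum) at most `4ε`.

Proof (constant `3`): for the cut `A_k = {i < k}` the purity is at most `u_k + ε²/u_k` with
`u_k = a_k / 2^k`, where `a_k` counts the diagonal ancilla labels `R ∈ {I,Z}^m` whose image
`f(I^n ⊗ R)` under the label map of `U` is supported in `A_k` (the stabilizers of the state inside
the cut): (ii) duality `2^m · b(A) = 4^{|A|} · a(Aᶜ)` by a double character sum, (i) isotropy
`a(A) · a(Aᶜ) ≤ 2^m`, the spectral-mass identity and the data/ancilla factorisation. The sequence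
`a_k` is monotone with `a_0 = 1` and `a_{n+m} = 2^m`, so `u_0 = 1`, `u_{n+m} = 2^{-n}` and
`u_{k+1} ≥ u_k / 2`: at the first `k` with `u_k ≤ 2ε` one has `u_k > ε`, whence purity
`≤ 2ε + ε = 3ε`; the degenerate ranges `ε ≥ 1/4` (cut `k = 0`) and `2ε < 2^{-n}` are direct.

PROVENANCE. The barrier docstring of `symplecticPurityBound` records that this statement was
machine-checked in the tree as
`Summit.QuantumAdvantage.QuantumAdvantage.Theorems.SymplecticPurity.SymplecticPurityBound_proof` (item
stmt-QuantumAdvantage-10729 of the retired route `SymplecticPurity`), with a body definitionally equal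
to the Literature `def`; `Literature` cannot import `Summits`, so the proof — the five files
`Summits/QuantumAdvantage/QuantumAdvantage/Theorems/SymplecticPuritySymplecticPurityBound{Pauli,Kernel,Tensor,Counting,}.lean`,
which use only Mathlib and `Literature.Computability.{QuantumComplexity.PauliParseval, Cryptography.QubitRegister}`
— is carried over here verbatim, one `section` per source file, as private helper lemmas in the
sub-namespace `…QuantumAdvantage.SymplecticPurityBound`, and closed as `symplecticPurityBound_holds`.

## References

* [AaronsonGottesman2004] S. Aaronson, D. Gottesman, *Improved simulation of stabilizer circuits*,
  Phys. Rev. A 70 (2004), 052328 (the stabilizer formalism behind the label map).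
-/

noncomputable section

namespace Literature.Barriers.QuantumAdvantage

open Matrix Finset
open Literature.Computability.QuantumComplexity Literature.Computability.Cryptography

namespace SymplecticPurityBound

section Pauli

/-! ### Source Pauli — helper file 1/5: Pauli-string algebra and the label map of a semantic Clifford unitary

Original module docstring:

# Route SymplecticPurity · item SymplecticPurityBound — Pauli-string algebra and the label map of
a Clifford unitary (helper file 1/5)

Helpers for `SymplecticPurityBound` (stmt-QuantumAdvantage-10729), over the Pauli vocabulary of
`Literature.Computability.QuantumComplexity.PauliExpansion` (Kempe–Regev–Unger–de Wolf §2):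

* scalars through `tensorAll`; the commutation rule `σ_S σ_T = sgn(S,T) σ_T σ_S` with the
  **commutation sign** `sgn(S,T) = ∏ᵢ sign(Sᵢ,Tᵢ) ∈ {±1}` (the symplectic form on Pauli labels);
* cancellation `a σ_S = b σ_T, b ≠ 0 ⟹ S = T` (trace orthogonality) and `σ_S σ_T ≠ 0`;
* products of two diagonal (`I`/`Z`) strings and of two strings with disjoint supports;
* the **label map of a semantic Clifford unitary**: a unitary `U` with a map `f` and phases `c`,
  `U σ_S U† = c(S) σ_{f(S)}`, `|c(S)| = 1` (this is how the route types Clifford frames; `f, c`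
  are carried as hypotheses, no new definitions). We show: `f` is injective, hence bijective, fixes
  the identity string, preserves the commutation sign (is symplectic), is multiplicative on the
  products the counting uses, and Pauli expectations pull back along it
  (`|⟨Uχ| σ_{f T} |Uχ⟩| = |⟨χ| σ_T |χ⟩|`), so spectral masses of `Uχ` are reindexed sums over `χ`.
-/


variable {ι : Type*} [Fintype ι] [DecidableEq ι]

/-! ## Scalars, commutation signs, cancellation -/

omit [DecidableEq ι] in
/-- Scalars come out of a tensor product: `⊗ᵢ (aᵢ Aᵢ) = (∏ᵢ aᵢ) · ⊗ᵢ Aᵢ`. [folklore] -/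
private theorem tensorAll_smul (a : ι → ℂ) (A : ι → Matrix Bool Bool ℂ) :
    tensorAll (fun i => a i • A i) = (∏ i, a i) • tensorAll A := by
  ext x y
  simp only [tensorAll_apply, Matrix.smul_apply, smul_eq_mul, Finset.prod_mul_distrib]

/-- One-qubit commutation rule: `σ_Q σ_P = sign(Q,P) · σ_P σ_Q`. [folklore] -/
private theorem pauli_mat_mul_mat_eq_sign_smul (Q P : Pauli) :
    Pauli.mat Q * Pauli.mat P = Pauli.sign Q P • (Pauli.mat P * Pauli.mat Q) := by
  calc Pauli.mat Q * Pauli.mat P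
      = Pauli.mat Q * Pauli.mat P * Pauli.mat Q * Pauli.mat Q := by
        rw [Matrix.mul_assoc (Pauli.mat Q * Pauli.mat P), Pauli.mat_mul_self, Matrix.mul_one]
    _ = (Pauli.sign Q P • Pauli.mat P) * Pauli.mat Q := by rw [Pauli.mat_mul_mat_mul_mat]
    _ = Pauli.sign Q P • (Pauli.mat P * Pauli.mat Q) := by rw [Matrix.smul_mul]

/-- Commutation rule for Pauli strings: `σ_S σ_T = sgn(S,T) · σ_T σ_S` with the commutation sign
`sgn(S,T) = ∏ᵢ sign(Sᵢ,Tᵢ)`.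
[folklore] -/
private theorem pauliString_mul_eq_sign_smul (S T : ι → Pauli) :
    pauliString S * pauliString T =
      (∏ i, Pauli.sign (S i) (T i)) • (pauliString T * pauliString S) := by
  rw [pauliString_eq, pauliString_eq, tensorAll_mul, tensorAll_mul, ← tensorAll_smul]
  congr 1
  funext i
  exact pauli_mat_mul_mat_eq_sign_smul (S i) (T i)

/-- A product of two Pauli strings is a nonzero matrix. [folklore] -/
private theorem pauliString_mul_pauliString_ne_zero (S T : ι → Pauli) :
    pauliString S * pauliString T ≠ 0 := by
  intro h
  have h1 : pauliString S * pauliString T * pauliString T * pauliString S = 1 := by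
    rw [Matrix.mul_assoc (pauliString S), pauliString_mul_self, Matrix.mul_one,
      pauliString_mul_self]
  rw [h, Matrix.zero_mul, Matrix.zero_mul] at h1
  have h2 := congrFun (congrFun h1 (fun _ => false)) (fun _ => false)
  simp at h2

/-- Cancelling a Pauli string: `a σ_S = b σ_T` with `b ≠ 0` forces `S = T`
(trace orthogonality of the strings).
[folklore] -/
private theorem eq_of_smul_pauliString_eq {S T : ι → Pauli} {a b : ℂ} (hb : b ≠ 0)
    (h : a • pauliString S = b • pauliString T) : S = T := by
  by_contra hST
  have h2 : a * (pauliString T * pauliString S).trace =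
      b * (pauliString T * pauliString T).trace := by
    have := congrArg (fun M => (pauliString T * M).trace) h
    simpa only [Matrix.mul_smul, Matrix.trace_smul, smul_eq_mul] using this
  rw [trace_pauliString_mul_pauliString, trace_pauliString_mul_pauliString,
    if_neg (Ne.symm hST), if_pos rfl, mul_zero] at h2
  exact mul_ne_zero hb (pow_ne_zero _ two_ne_zero) h2.symm

omit [DecidableEq ι] in
/-- Equal scalar multiples of a nonzero matrix have equal scalars. [folklore] -/
private theorem smul_left_cancel_of_ne_zero {M : Matrix (ι → Bool) (ι → Bool) ℂ} (hM : M ≠ 0) {a b : ℂ}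
    (h : a • M = b • M) : a = b := by
  have h' : (a - b) • M = 0 := by rw [sub_smul, h, sub_self]
  rcases smul_eq_zero.1 h' with h'' | h''
  · exact sub_eq_zero.1 h''
  · exact absurd h'' hM

/-! ## Products of special strings -/

/-- Products of diagonal letters: for `p, q ∈ {I, Z}`, `σ_p σ_q = σ_{p·q}` with `p·q = I` if
`p = q` and `Z` otherwise.
[folklore] -/
private theorem pauli_mat_mul_mat_of_IZ {p q : Pauli} (hp : p = Pauli.I ∨ p = Pauli.Z)
    (hq : q = Pauli.I ∨ q = Pauli.Z) :
    Pauli.mat p * Pauli.mat q = Pauli.mat (if p = q then Pauli.I else Pauli.Z) := by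
  rcases hp with rfl | rfl <;> rcases hq with rfl | rfl
  · rw [if_pos rfl, Pauli.mat_mul_self]; rfl
  · rw [if_neg (by decide)]
    show 1 * Pauli.mat Pauli.Z = _
    rw [Matrix.one_mul]
  · rw [if_neg (by decide)]
    show Pauli.mat Pauli.Z * 1 = _
    rw [Matrix.mul_one]
  · rw [if_pos rfl, Pauli.mat_mul_self]; rfl

/-- Products of diagonal strings: for `z, z' ∈ {I,Z}^ι`, `σ_z σ_{z'} = σ_{z·z'}` (no phase). [folklore] -/
private theorem pauliString_mul_of_IZ {z z' : ι → Pauli} (hz : ∀ i, z i = Pauli.I ∨ z i = Pauli.Z)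
    (hz' : ∀ i, z' i = Pauli.I ∨ z' i = Pauli.Z) :
    pauliString z * pauliString z' =
      pauliString (fun i => if z i = z' i then Pauli.I else Pauli.Z) := by
  rw [pauliString_eq, pauliString_eq, tensorAll_mul, pauliString_eq]
  congr 1
  funext i
  exact pauli_mat_mul_mat_of_IZ (hz i) (hz' i)

/-- Products of strings with disjoint supports: if `S` lives on `A` and `T` off `A`, then
`σ_S σ_T` is the string that is `S` on `A` and `T` off `A` (no phase).
[folklore] -/
private theorem pauliString_mul_of_disjoint {A : Finset ι} {S T : ι → Pauli} (hS : S ∈ stringsOn A)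
    (hT : T ∈ stringsOn Aᶜ) :
    pauliString S * pauliString T = pauliString (fun i => if i ∈ A then S i else T i) := by
  rw [pauliString_eq, pauliString_eq, tensorAll_mul, pauliString_eq]
  congr 1
  funext i
  by_cases hi : i ∈ A
  · rw [if_pos hi, mem_stringsOn.1 hT i (fun h => (Finset.mem_compl.1 h) hi)]
    show Pauli.mat (S i) * 1 = _
    rw [Matrix.mul_one]
  · rw [if_neg hi, mem_stringsOn.1 hS i hi]
    show 1 * Pauli.mat (T i) = _
    rw [Matrix.one_mul]

/-! ## The Pauli-label map of a semantic Clifford unitary -/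


/-- Unit-modulus phases are nonzero. [folklore] -/
private theorem ne_zero_of_norm_eq_one {c : ℂ} (h : ‖c‖ = 1) : c ≠ 0 := by
  intro hc
  rw [hc, norm_zero] at h
  exact zero_ne_one h

/-- Undoing a conjugation: `U† (U M U†) U = M` when `U† U = 1`. [folklore] -/
private theorem conjTranspose_mul_conj_mul {U : Matrix (ι → Bool) (ι → Bool) ℂ} (hU : Uᴴ * U = 1)
    (M : Matrix (ι → Bool) (ι → Bool) ℂ) : Uᴴ * (U * M * Uᴴ) * U = M := by
  simp only [← Matrix.mul_assoc]
  rw [hU, Matrix.one_mul, Matrix.mul_assoc, hU, Matrix.mul_one]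

/-- Conjugation is multiplicative: `U (A B) U† = (U A U†)(U B U†)` when `U† U = 1`. [folklore] -/
private theorem conj_mul_eq {U : Matrix (ι → Bool) (ι → Bool) ℂ} (hU : Uᴴ * U = 1)
    (A B : Matrix (ι → Bool) (ι → Bool) ℂ) :
    U * (A * B) * Uᴴ = (U * A * Uᴴ) * (U * B * Uᴴ) := by
  simp only [Matrix.mul_assoc]
  rw [← Matrix.mul_assoc Uᴴ U, hU, Matrix.one_mul]

/-- **The label map of a Clifford unitary is injective.** [folklore] -/
private theorem clifford_injective {U : Matrix (ι → Bool) (ι → Bool) ℂ} (hU : Uᴴ * U = 1)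
    {f : (ι → Pauli) → (ι → Pauli)} {c : (ι → Pauli) → ℂ}
    (hf : ∀ S, ‖c S‖ = 1 ∧ U * pauliString S * Uᴴ = c S • pauliString (f S)) :
    Function.Injective f := by
  intro S T hST
  have hS := (hf S).2
  have hT := (hf T).2
  rw [hST] at hS
  have h1 : c T • (U * pauliString S * Uᴴ) = c S • (U * pauliString T * Uᴴ) := by
    rw [hS, hT, smul_smul, smul_smul, mul_comm]
  have h3 := congrArg (fun M => Uᴴ * M * U) h1
  simp only [Matrix.mul_smul, Matrix.smul_mul, conjTranspose_mul_conj_mul hU] at h3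
  exact eq_of_smul_pauliString_eq (ne_zero_of_norm_eq_one (hf S).1) h3

/-- **The label map of a Clifford unitary is a bijection** of the finite set of Pauli strings. [folklore] -/
private theorem clifford_bijective {U : Matrix (ι → Bool) (ι → Bool) ℂ} (hU : Uᴴ * U = 1)
    {f : (ι → Pauli) → (ι → Pauli)} {c : (ι → Pauli) → ℂ}
    (hf : ∀ S, ‖c S‖ = 1 ∧ U * pauliString S * Uᴴ = c S • pauliString (f S)) :
    Function.Bijective f :=
  ⟨clifford_injective hU hf, Finite.surjective_of_injective (clifford_injective hU hf)⟩

/-- **The label map fixes the identity string.** [folklore] -/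
private theorem clifford_map_I {U : Matrix (ι → Bool) (ι → Bool) ℂ} (hU' : U * Uᴴ = 1)
    {f : (ι → Pauli) → (ι → Pauli)} {c : (ι → Pauli) → ℂ}
    (hf : ∀ S, ‖c S‖ = 1 ∧ U * pauliString S * Uᴴ = c S • pauliString (f S)) :
    f (fun _ => Pauli.I) = fun _ => Pauli.I := by
  have h := (hf (fun _ => Pauli.I)).2
  rw [pauliString_const_I, Matrix.mul_one, hU'] at h
  have h' : (1 : ℂ) • pauliString (fun _ : ι => Pauli.I) =
      c (fun _ => Pauli.I) • pauliString (f fun _ => Pauli.I) := by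
    rw [one_smul, pauliString_const_I]
    exact h
  exact (eq_of_smul_pauliString_eq (ne_zero_of_norm_eq_one (hf _).1) h').symm

/-- Conjugating a product of two strings. [folklore] -/
private theorem clifford_conj_mul {U : Matrix (ι → Bool) (ι → Bool) ℂ} (hU : Uᴴ * U = 1)
    {f : (ι → Pauli) → (ι → Pauli)} {c : (ι → Pauli) → ℂ}
    (hf : ∀ S, ‖c S‖ = 1 ∧ U * pauliString S * Uᴴ = c S • pauliString (f S)) (S T : ι → Pauli) :
    U * (pauliString S * pauliString T) * Uᴴ =
      (c S * c T) • (pauliString (f S) * pauliString (f T)) := by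
  rw [conj_mul_eq hU, (hf S).2, (hf T).2, Matrix.smul_mul, Matrix.mul_smul, smul_smul, mul_comm]

/-- **The label map preserves the commutation sign** (`f` is symplectic):
`sgn(f S, f T) = sgn(S, T)`.
[folklore] -/
private theorem clifford_sign {U : Matrix (ι → Bool) (ι → Bool) ℂ} (hU : Uᴴ * U = 1)
    {f : (ι → Pauli) → (ι → Pauli)} {c : (ι → Pauli) → ℂ}
    (hf : ∀ S, ‖c S‖ = 1 ∧ U * pauliString S * Uᴴ = c S • pauliString (f S)) (S T : ι → Pauli) :
    ∏ i, Pauli.sign (f S i) (f T i) = ∏ i, Pauli.sign (S i) (T i) := by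
  have key := clifford_conj_mul hU hf S T
  have key' := clifford_conj_mul hU hf T S
  have h1 : (c S * c T) • (pauliString (f S) * pauliString (f T)) =
      (∏ i, Pauli.sign (S i) (T i)) • ((c T * c S) • (pauliString (f T) * pauliString (f S))) := by
    rw [← key, ← key', pauliString_mul_eq_sign_smul S T, Matrix.mul_smul, Matrix.smul_mul]
  rw [pauliString_mul_eq_sign_smul (f S) (f T), smul_smul, smul_smul] at h1
  have h2 := smul_left_cancel_of_ne_zero (pauliString_mul_pauliString_ne_zero _ _) h1
  have hc : c S * c T ≠ 0 :=
    mul_ne_zero (ne_zero_of_norm_eq_one (hf S).1) (ne_zero_of_norm_eq_one (hf T).1)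
  rw [mul_comm (c T) (c S), mul_comm (∏ i, Pauli.sign (S i) (T i))] at h2
  exact mul_left_cancel₀ hc h2

/-- **Multiplicativity on diagonal strings with separated images**: if `z, z' ∈ {I,Z}^ι` and
`f z` lives on `A`, `f z'` off `A`, then `f (z·z')` is `f z` on `A` and `f z'` off `A`.
[folklore] -/
private theorem clifford_map_mul_of_IZ {U : Matrix (ι → Bool) (ι → Bool) ℂ} (hU : Uᴴ * U = 1)
    {f : (ι → Pauli) → (ι → Pauli)} {c : (ι → Pauli) → ℂ}
    (hf : ∀ S, ‖c S‖ = 1 ∧ U * pauliString S * Uᴴ = c S • pauliString (f S))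
    {A : Finset ι} {z z' : ι → Pauli} (hz : ∀ i, z i = Pauli.I ∨ z i = Pauli.Z)
    (hz' : ∀ i, z' i = Pauli.I ∨ z' i = Pauli.Z) (hA : f z ∈ stringsOn A)
    (hA' : f z' ∈ stringsOn Aᶜ) :
    f (fun i => if z i = z' i then Pauli.I else Pauli.Z) =
      fun i => if i ∈ A then f z i else f z' i := by
  have key := clifford_conj_mul hU hf z z'
  rw [pauliString_mul_of_IZ hz hz', pauliString_mul_of_disjoint hA hA', (hf _).2] at key
  exact eq_of_smul_pauliString_eq
    (mul_ne_zero (ne_zero_of_norm_eq_one (hf z).1) (ne_zero_of_norm_eq_one (hf z').1)) key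

/-! ## Pulling back expectations -/

/-- Unitaries preserve inner products: `⟨Uv, Uw⟩ = ⟨v, w⟩` when `U† U = 1`. [folklore] -/
private theorem star_mulVec_dotProduct_mulVec {U : Matrix (ι → Bool) (ι → Bool) ℂ} (hU : Uᴴ * U = 1)
    (v w : (ι → Bool) → ℂ) : star (U *ᵥ v) ⬝ᵥ (U *ᵥ w) = star v ⬝ᵥ w := by
  rw [Matrix.star_mulVec, ← Matrix.dotProduct_mulVec, Matrix.mulVec_mulVec, hU, Matrix.one_mulVec]

/-- **Pull-back of Pauli expectations through a Clifford unitary**: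
`|⟨Uχ| σ_{f T} |Uχ⟩| = |⟨χ| σ_T |χ⟩|`.
[folklore] -/
private theorem norm_exp_clifford {U : Matrix (ι → Bool) (ι → Bool) ℂ} (hU : Uᴴ * U = 1)
    {f : (ι → Pauli) → (ι → Pauli)} {c : (ι → Pauli) → ℂ}
    (hf : ∀ S, ‖c S‖ = 1 ∧ U * pauliString S * Uᴴ = c S • pauliString (f S))
    (χ : (ι → Bool) → ℂ) (T : ι → Pauli) :
    ‖star (U *ᵥ χ) ⬝ᵥ (pauliString (f T) *ᵥ (U *ᵥ χ))‖ = ‖star χ ⬝ᵥ (pauliString T *ᵥ χ)‖ := by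
  have hc : c T ≠ 0 := ne_zero_of_norm_eq_one (hf T).1
  have h1 : pauliString (f T) = (c T)⁻¹ • (U * pauliString T * Uᴴ) := by
    rw [(hf T).2, smul_smul, inv_mul_cancel₀ hc, one_smul]
  have h2 : pauliString (f T) *ᵥ (U *ᵥ χ) = (c T)⁻¹ • (U *ᵥ (pauliString T *ᵥ χ)) := by
    rw [h1, Matrix.smul_mulVec, Matrix.mulVec_mulVec, Matrix.mul_assoc, hU, Matrix.mul_one,
      ← Matrix.mulVec_mulVec]
  rw [h2, dotProduct_smul, star_mulVec_dotProduct_mulVec hU, smul_eq_mul, norm_mul, norm_inv,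
    (hf T).1, inv_one, one_mul]

/-- **Reindexing along the label map**: summing `g ∘ f` over `f⁻¹(s)` is summing `g` over `s`. [folklore] -/
private theorem sum_filter_comp_clifford {U : Matrix (ι → Bool) (ι → Bool) ℂ} (hU : Uᴴ * U = 1)
    {f : (ι → Pauli) → (ι → Pauli)} {c : (ι → Pauli) → ℂ}
    (hf : ∀ S, ‖c S‖ = 1 ∧ U * pauliString S * Uᴴ = c S • pauliString (f S))
    {M : Type*} [AddCommMonoid M] (s : Finset (ι → Pauli)) (g : (ι → Pauli) → M) :
    ∑ T ∈ Finset.univ.filter (fun T => f T ∈ s), g (f T) = ∑ Q ∈ s, g Q := by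
  have step1 : ∑ Q ∈ s, g Q = ∑ Q, (if Q ∈ s then g Q else 0) := by
    rw [Finset.sum_ite_mem, Finset.univ_inter]
  rw [step1, Finset.sum_filter]
  exact (Equiv.ofBijective f (clifford_bijective hU hf)).sum_comp
    (fun Q => if Q ∈ s then g Q else 0)

/-- **Spectral mass pulls back along the label map**: the mass of `Uχ` on the strings supported
in `A` equals the mass of `χ` on `{T : f T ∈ 𝒫_A}`.
[folklore] -/
private theorem sum_stringsOn_norm_exp_sq_clifford {U : Matrix (ι → Bool) (ι → Bool) ℂ} (hU : Uᴴ * U = 1)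
    {f : (ι → Pauli) → (ι → Pauli)} {c : (ι → Pauli) → ℂ}
    (hf : ∀ S, ‖c S‖ = 1 ∧ U * pauliString S * Uᴴ = c S • pauliString (f S))
    (χ : (ι → Bool) → ℂ) (A : Finset ι) :
    ∑ Q ∈ stringsOn A, ‖star (U *ᵥ χ) ⬝ᵥ (pauliString Q *ᵥ (U *ᵥ χ))‖ ^ 2 =
      ∑ T ∈ Finset.univ.filter (fun T => f T ∈ stringsOn A),
        ‖star χ ⬝ᵥ (pauliString T *ᵥ χ)‖ ^ 2 := by
  rw [← sum_filter_comp_clifford hU hf (stringsOn A)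
    (fun Q => ‖star (U *ᵥ χ) ⬝ᵥ (pauliString Q *ᵥ (U *ᵥ χ))‖ ^ 2)]
  exact Finset.sum_congr rfl fun T _ => by rw [norm_exp_clifford hU hf χ T]


end Pauli

section Kernel

/-! ### Source Kernel — helper file 2/5: spectral mass of a wire set and the product formulas

Original module docstring:

# Route SymplecticPurity · item SymplecticPurityBound — purity of a cut as Pauli spectral mass,
and Pauli character sums (helper file 2/5)

For a vector `φ` on a register `ι → Bool` and a wire set `W`, the purity `Tr ρ_W²` of the reduced
state on `W`, written as the four-fold agreement sum
`Σ [x₁ =_{Wᶜ} x₂] [x₂ =_W x₃] [x₃ =_{Wᶜ} x₄] [x₄ =_W x₁] φ(x₁) φ̄(x₂) φ(x₃) φ̄(x₄)`,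
equals `2^{-|W|} Σ_{S ∈ 𝒫_W} |⟨φ|σ_S|φ⟩|²` (Kempe–Regev–Unger–de Wolf, Quantum Inf. Comput. 10
(2010), §2–3: Parseval on the block together with Observation 3). We prove it directly from the
four-label completeness kernel of the strings supported in `W` (the `if`s carry an arbitrary
`Decidable` instance so that the identity rewrites the route statement verbatim), and record the two
extreme cuts (`W = ∅`, `W = univ`), where the sum is `‖φ‖⁴`.

The second part evaluates the **character sums of the commutation sign**
`sgn(Q,R) = ∏ᵢ sign(Qᵢ,Rᵢ)`: over the strings supported in `A`
(`Σ_{Q ∈ 𝒫_A} sgn(Q,R) = 4^{|A|} [R|_A = I]`, Observation 4 of Kempe et al. on every wire) and over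
the diagonal strings `I^n ⊗ {I,Z}^m` (`= 2^m [R|_anc ∈ {I,Z}^m]`).
-/


variable {ι : Type*} [Fintype ι] [DecidableEq ι]

/-- **Four-label completeness kernel of the strings on `W`**:
`Σ_{S ∈ 𝒫_W} S_{xy} conj(S_{x'y'}) = 2^{|W|}` if `x, x'` and `y, y'` agree on `W` while `x, y` and
`x', y'` agree off `W`; `0` otherwise.
[folklore] -/
private theorem sum_stringsOn_apply_mul_star_apply_eq (W : Finset ι) (x y x' y' : ι → Bool) :
    ∑ S ∈ stringsOn W, pauliString S x y * star (pauliString S x' y') =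
      if (∀ i ∈ W, x i = x' i ∧ y i = y' i) ∧ (∀ i ∉ W, x i = y i ∧ x' i = y' i)
      then (2 : ℂ) ^ W.card else 0 := by
  have hstar : ∀ S : ι → Pauli, star (pauliString S x' y') = pauliString S y' x' := fun S => by
    have := congrFun (congrFun (conjTranspose_pauliString S) y') x'
    rwa [Matrix.conjTranspose_apply] at this
  simp only [hstar]
  simp only [pauliString_eq, tensorAll_apply, ← Finset.prod_mul_distrib, stringsOn]
  rw [← Finset.prod_univ_sum (fun i => if i ∈ W then Finset.univ else {Pauli.I})
    (fun i Q => Pauli.mat Q (x i) (y i) * Pauli.mat Q (y' i) (x' i))]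
  have key : ∀ i, (∑ Q ∈ (if i ∈ W then Finset.univ else {Pauli.I}),
      Pauli.mat Q (x i) (y i) * Pauli.mat Q (y' i) (x' i)) =
      if (i ∈ W → x i = x' i ∧ y i = y' i) ∧ (i ∉ W → x i = y i ∧ x' i = y' i)
      then (if i ∈ W then 2 else 1) else 0 := by
    intro i
    by_cases hi : i ∈ W
    · simp only [hi, if_true, Pauli.sum_mat_mul_mat, true_implies, not_true_eq_false,
        false_implies, and_true]
    · simp only [hi, if_false, Finset.sum_singleton, Pauli.mat_I_apply, false_implies, true_and,
        not_false_eq_true, true_implies]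
      by_cases h1 : x i = y i <;> by_cases h2 : x' i = y' i <;> simp [h1, h2, eq_comm]
  simp only [key]
  rw [Fintype.prod_ite_zero]
  have hprod : (∏ i : ι, (if i ∈ W then (2 : ℂ) else 1)) = 2 ^ W.card := by
    rw [Finset.prod_ite_mem, Finset.univ_inter, Finset.prod_const]
  rw [hprod]
  by_cases h : (∀ i ∈ W, x i = x' i ∧ y i = y' i) ∧ (∀ i ∉ W, x i = y i ∧ x' i = y' i)
  · rw [if_pos h, if_pos (fun i => ⟨fun hi => h.1 i hi, fun hi => h.2 i hi⟩)]
  · rw [if_neg h, if_neg (fun h' => h ⟨fun i hi => (h' i).1 hi, fun i hi => (h' i).2 hi⟩)]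

/-- The expectation `⟨φ|σ_S|φ⟩` as a double sum over labels. [folklore] -/
private theorem star_dotProduct_pauliString_mulVec (φ : (ι → Bool) → ℂ) (S : ι → Pauli) :
    star φ ⬝ᵥ (pauliString S *ᵥ φ) =
      ∑ p : (ι → Bool) × (ι → Bool), star (φ p.1) * (pauliString S p.1 p.2 * φ p.2) := by
  rw [Fintype.sum_prod_type]
  simp only [dotProduct, Matrix.mulVec, Pi.star_apply, Finset.mul_sum]

/-- **Purity of a cut as Pauli spectral mass** (complex form):
`Σ_{S ∈ 𝒫_W} ⟨φ|σ_S|φ⟩ conj⟨φ|σ_S|φ⟩ = 2^{|W|} · (four-fold agreement sum)`.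
[folklore] -/
private theorem sum_stringsOn_exp_mul_star_exp (φ : (ι → Bool) → ℂ) (W : Finset ι)
    [D : ∀ x₁ x₂ x₃ x₄ : ι → Bool, Decidable ((∀ i ∉ W, x₁ i = x₂ i) ∧ (∀ i ∈ W, x₂ i = x₃ i) ∧
      (∀ i ∉ W, x₃ i = x₄ i) ∧ (∀ i ∈ W, x₄ i = x₁ i))] :
    ∑ S ∈ stringsOn W, (star φ ⬝ᵥ (pauliString S *ᵥ φ)) * star (star φ ⬝ᵥ (pauliString S *ᵥ φ)) =
      (2 : ℂ) ^ W.card * ∑ x₁ : ι → Bool, ∑ x₂ : ι → Bool, ∑ x₃ : ι → Bool, ∑ x₄ : ι → Bool,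
        (if (∀ i ∉ W, x₁ i = x₂ i) ∧ (∀ i ∈ W, x₂ i = x₃ i) ∧ (∀ i ∉ W, x₃ i = x₄ i) ∧
            (∀ i ∈ W, x₄ i = x₁ i)
         then φ x₁ * star (φ x₂) * φ x₃ * star (φ x₄) else 0) := by
  -- Step 1: each term as a double sum over pairs of label pairs
  have h1 : ∀ S : ι → Pauli,
      (star φ ⬝ᵥ (pauliString S *ᵥ φ)) * star (star φ ⬝ᵥ (pauliString S *ᵥ φ)) =
        ∑ p : (ι → Bool) × (ι → Bool), ∑ q : (ι → Bool) × (ι → Bool),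
          (star (φ p.1) * φ p.2 * φ q.1 * star (φ q.2)) *
            (pauliString S p.1 p.2 * star (pauliString S q.1 q.2)) := by
    intro S
    rw [star_dotProduct_pauliString_mulVec, star_sum, Finset.sum_mul_sum]
    refine Finset.sum_congr rfl fun p _ => Finset.sum_congr rfl fun q _ => ?_
    simp only [star_mul', star_star]
    ring
  simp only [h1]
  -- Step 2: move the sum over strings inside and evaluate the kernel
  rw [Finset.sum_comm]
  simp only [Finset.sum_comm (s := stringsOn W), ← Finset.mul_sum,
    sum_stringsOn_apply_mul_star_apply_eq, mul_ite, mul_zero]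
  -- Step 3: relabel `(x₁, x₂, x₃, x₄) = (p.2, p.1, q.1, q.2)`
  rw [Finset.mul_sum, Fintype.sum_prod_type, Finset.sum_comm]
  refine Finset.sum_congr rfl fun x₁ _ => ?_
  rw [Finset.mul_sum]
  refine Finset.sum_congr rfl fun x₂ _ => ?_
  rw [Fintype.sum_prod_type, Finset.mul_sum]
  refine Finset.sum_congr rfl fun x₃ _ => ?_
  rw [Finset.mul_sum]
  refine Finset.sum_congr rfl fun x₄ _ => ?_
  by_cases h : (∀ i ∉ W, x₁ i = x₂ i) ∧ (∀ i ∈ W, x₂ i = x₃ i) ∧ (∀ i ∉ W, x₃ i = x₄ i) ∧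
      (∀ i ∈ W, x₄ i = x₁ i)
  · rw [if_pos h, if_pos]
    · ring
    · exact ⟨fun i hi => ⟨h.2.1 i hi, (h.2.2.2 i hi).symm⟩,
        fun i hi => ⟨(h.1 i hi).symm, h.2.2.1 i hi⟩⟩
  · rw [if_neg h, if_neg, mul_zero]
    intro h'
    exact h ⟨fun i hi => ((h'.2 i hi).1).symm, fun i hi => (h'.1 i hi).1,
      fun i hi => (h'.2 i hi).2, fun i hi => ((h'.1 i hi).2).symm⟩

/-- **Purity of a cut as Pauli spectral mass**: the four-fold agreement sum of `φ` across the cut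
`W | Wᶜ` is the real number `2^{-|W|} Σ_{S ∈ 𝒫_W} |⟨φ|σ_S|φ⟩|²`.
[folklore] -/
private theorem fourFold_eq_spectralMass (φ : (ι → Bool) → ℂ) (W : Finset ι)
    [D : ∀ x₁ x₂ x₃ x₄ : ι → Bool, Decidable ((∀ i ∉ W, x₁ i = x₂ i) ∧ (∀ i ∈ W, x₂ i = x₃ i) ∧
      (∀ i ∉ W, x₃ i = x₄ i) ∧ (∀ i ∈ W, x₄ i = x₁ i))] :
    (∑ x₁ : ι → Bool, ∑ x₂ : ι → Bool, ∑ x₃ : ι → Bool, ∑ x₄ : ι → Bool,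
        (if (∀ i ∉ W, x₁ i = x₂ i) ∧ (∀ i ∈ W, x₂ i = x₃ i) ∧ (∀ i ∉ W, x₃ i = x₄ i) ∧
            (∀ i ∈ W, x₄ i = x₁ i)
         then φ x₁ * star (φ x₂) * φ x₃ * star (φ x₄) else 0)) =
      ((((2 : ℝ) ^ W.card)⁻¹ * ∑ S ∈ stringsOn W, ‖star φ ⬝ᵥ (pauliString S *ᵥ φ)‖ ^ 2 : ℝ) : ℂ) := by
  have h := sum_stringsOn_exp_mul_star_exp φ W
  have h2 : ((∑ S ∈ stringsOn W, ‖star φ ⬝ᵥ (pauliString S *ᵥ φ)‖ ^ 2 : ℝ) : ℂ) =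
      ∑ S ∈ stringsOn W, (star φ ⬝ᵥ (pauliString S *ᵥ φ)) * star (star φ ⬝ᵥ (pauliString S *ᵥ φ)) := by
    push_cast
    refine Finset.sum_congr rfl fun S _ => ?_
    rw [Complex.star_def, Complex.mul_conj']
  have hpow : ((2 : ℂ) ^ W.card) ≠ 0 := pow_ne_zero _ two_ne_zero
  rw [Complex.ofReal_mul, Complex.ofReal_inv, Complex.ofReal_pow, Complex.ofReal_ofNat, h2, h,
    ← mul_assoc, inv_mul_cancel₀ hpow, one_mul]

/-- `⟨φ|σ_I|φ⟩ = ⟨φ|φ⟩ = Σ |φ x|²`. [folklore] -/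
private theorem star_dotProduct_pauliString_I_mulVec (φ : (ι → Bool) → ℂ) :
    star φ ⬝ᵥ (pauliString (fun _ : ι => Pauli.I) *ᵥ φ) = ((∑ x, ‖φ x‖ ^ 2 : ℝ) : ℂ) := by
  rw [pauliString_const_I, Matrix.one_mulVec]
  push_cast
  simp only [dotProduct, Pi.star_apply]
  refine Finset.sum_congr rfl fun x _ => ?_
  rw [Complex.star_def, Complex.conj_mul']

/-- The four-fold sum at the empty cut is `‖φ‖⁴`. [folklore] -/
private theorem fourFold_empty (φ : (ι → Bool) → ℂ)
    [D : ∀ x₁ x₂ x₃ x₄ : ι → Bool, Decidable ((∀ i ∉ (∅ : Finset ι), x₁ i = x₂ i) ∧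
      (∀ i ∈ (∅ : Finset ι), x₂ i = x₃ i) ∧ (∀ i ∉ (∅ : Finset ι), x₃ i = x₄ i) ∧
      (∀ i ∈ (∅ : Finset ι), x₄ i = x₁ i))] :
    (∑ x₁ : ι → Bool, ∑ x₂ : ι → Bool, ∑ x₃ : ι → Bool, ∑ x₄ : ι → Bool,
        (if (∀ i ∉ (∅ : Finset ι), x₁ i = x₂ i) ∧ (∀ i ∈ (∅ : Finset ι), x₂ i = x₃ i) ∧
            (∀ i ∉ (∅ : Finset ι), x₃ i = x₄ i) ∧ (∀ i ∈ (∅ : Finset ι), x₄ i = x₁ i)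
         then φ x₁ * star (φ x₂) * φ x₃ * star (φ x₄) else 0)) =
      (((∑ x, ‖φ x‖ ^ 2) ^ 2 : ℝ) : ℂ) := by
  rw [fourFold_eq_spectralMass, stringsOn_empty, Finset.sum_singleton,
    star_dotProduct_pauliString_I_mulVec, Complex.norm_real, Real.norm_eq_abs, sq_abs,
    Finset.card_empty, pow_zero, inv_one, one_mul]

/-- `⟨φ|σ_S|φ⟩` is the Pauli coefficient `Tr(σ_S |φ⟩⟨φ|)` of the rank-one matrix `|φ⟩⟨φ|`. [folklore] -/
private theorem star_dotProduct_pauliString_mulVec_eq_pauliCoeff (φ : (ι → Bool) → ℂ) (S : ι → Pauli) :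
    star φ ⬝ᵥ (pauliString S *ᵥ φ) = pauliCoeff (vecMulVec φ (star φ)) S := by
  rw [pauliCoeff_eq, Matrix.trace]
  simp only [Matrix.diag_apply, Matrix.mul_apply, vecMulVec_apply, Pi.star_apply, dotProduct,
    Matrix.mulVec, Finset.mul_sum]
  refine Finset.sum_congr rfl fun x _ => Finset.sum_congr rfl fun y _ => ?_
  ring

/-- **Parseval for a vector state**: `Σ_S |⟨φ|σ_S|φ⟩|² = 2^{|ι|} ‖φ‖⁴`. [folklore] -/
private theorem sum_norm_exp_sq (φ : (ι → Bool) → ℂ) :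
    ∑ S : ι → Pauli, ‖star φ ⬝ᵥ (pauliString S *ᵥ φ)‖ ^ 2 =
      (2 : ℝ) ^ Fintype.card ι * (∑ x, ‖φ x‖ ^ 2) ^ 2 := by
  simp only [star_dotProduct_pauliString_mulVec_eq_pauliCoeff, sum_norm_pauliCoeff_sq]
  congr 1
  simp only [vecMulVec_apply, Pi.star_apply, norm_mul, norm_star, mul_pow]
  rw [sq, Finset.sum_mul_sum]

/-- The four-fold sum at the full cut is `‖φ‖⁴`. [folklore] -/
private theorem fourFold_univ (φ : (ι → Bool) → ℂ)
    [D : ∀ x₁ x₂ x₃ x₄ : ι → Bool, Decidable ((∀ i ∉ (Finset.univ : Finset ι), x₁ i = x₂ i) ∧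
      (∀ i ∈ (Finset.univ : Finset ι), x₂ i = x₃ i) ∧
      (∀ i ∉ (Finset.univ : Finset ι), x₃ i = x₄ i) ∧
      (∀ i ∈ (Finset.univ : Finset ι), x₄ i = x₁ i))] :
    (∑ x₁ : ι → Bool, ∑ x₂ : ι → Bool, ∑ x₃ : ι → Bool, ∑ x₄ : ι → Bool,
        (if (∀ i ∉ (Finset.univ : Finset ι), x₁ i = x₂ i) ∧
            (∀ i ∈ (Finset.univ : Finset ι), x₂ i = x₃ i) ∧
            (∀ i ∉ (Finset.univ : Finset ι), x₃ i = x₄ i) ∧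
            (∀ i ∈ (Finset.univ : Finset ι), x₄ i = x₁ i)
         then φ x₁ * star (φ x₂) * φ x₃ * star (φ x₄) else 0)) =
      (((∑ x, ‖φ x‖ ^ 2) ^ 2 : ℝ) : ℂ) := by
  rw [fourFold_eq_spectralMass, stringsOn_univ, sum_norm_exp_sq, Finset.card_univ, ← mul_assoc,
    inv_mul_cancel₀ (pow_ne_zero _ two_ne_zero), one_mul]

/-! ## Character sums of the commutation sign

The finite-group input of the stabilizer counting: orthogonality of the characters
`Q ↦ sgn(Q,R)` on product families of strings. -/

/-- `sign(q, I) = 1`: everything commutes with the identity. [folklore] -/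
private theorem pauli_sign_I_right (q : Pauli) : Pauli.sign q Pauli.I = 1 := by
  cases q <;> simp [Pauli.sign]

/-- `sign(I, q) = 1`. [folklore] -/
private theorem pauli_sign_I_left (q : Pauli) : Pauli.sign Pauli.I q = 1 := by
  cases q <;> simp [Pauli.sign]

/-- Signs against the diagonal letters: `Σ_{q ∈ {I,Z}} sign(p,q) = 2 [p ∈ {I,Z}]`. [folklore] -/
private theorem sum_pair_IZ_sign (p : Pauli) :
    ∑ q ∈ ({Pauli.I, Pauli.Z} : Finset Pauli), Pauli.sign p q =
      if p = Pauli.I ∨ p = Pauli.Z then 2 else 0 := by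
  rw [Finset.sum_pair (by decide)]
  cases p <;> simp [Pauli.sign] <;> norm_num

/-- **Character sum over the strings on a wire set** (Observation 4 of Kempe et al. on every wire
of `A`): `Σ_{Q ∈ 𝒫_A} sgn(Q,R) = 4^{|A|}` if `R` is the identity on `A`, and `0` otherwise.
[folklore] -/
private theorem sum_stringsOn_prod_sign (A : Finset ι) (R : ι → Pauli) :
    ∑ Q ∈ stringsOn A, ∏ i, Pauli.sign (Q i) (R i) =
      if ∀ i ∈ A, R i = Pauli.I then (4 : ℂ) ^ A.card else 0 := by
  rw [stringsOn, ← Finset.prod_univ_sum (fun i => if i ∈ A then Finset.univ else {Pauli.I})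
    (fun i q => Pauli.sign q (R i))]
  have key : ∀ i, (∑ q ∈ (if i ∈ A then Finset.univ else {Pauli.I}), Pauli.sign q (R i)) =
      if (i ∈ A → R i = Pauli.I) then (if i ∈ A then 4 else 1) else 0 := by
    intro i
    by_cases hi : i ∈ A
    · simp only [hi, if_true, Pauli.sum_sign, true_implies]
    · simp [hi, pauli_sign_I_left]
  simp only [key]
  rw [Fintype.prod_ite_zero]
  have hprod : (∏ i : ι, (if i ∈ A then (4 : ℂ) else 1)) = 4 ^ A.card := by
    rw [Finset.prod_ite_mem, Finset.univ_inter, Finset.prod_const]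
  rw [hprod]

/-- **Character sum over the diagonal strings** `I^n ⊗ {I,Z}^m`:
`Σ_{z} sgn(T,z) = 2^m` if `T` is diagonal (`I` or `Z`) on the last `m` wires, `0` otherwise.
[folklore] -/
private theorem sum_piFinset_IZ_prod_sign (n m : ℕ) (T : Fin (n + m) → Pauli) :
    ∑ R ∈ Fintype.piFinset (fun _ : Fin m => ({Pauli.I, Pauli.Z} : Finset Pauli)),
        ∏ i, Pauli.sign (T i) (Fin.append (fun _ : Fin n => Pauli.I) R i) =
      if ∀ j : Fin m, T (Fin.natAdd n j) = Pauli.I ∨ T (Fin.natAdd n j) = Pauli.Z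
      then (2 : ℂ) ^ m else 0 := by
  have h1 : ∀ R : Fin m → Pauli,
      ∏ i, Pauli.sign (T i) (Fin.append (fun _ : Fin n => Pauli.I) R i) =
        ∏ j, Pauli.sign (T (Fin.natAdd n j)) (R j) := by
    intro R
    rw [Fin.prod_univ_add]
    simp only [Fin.append_left, Fin.append_right, pauli_sign_I_right, Finset.prod_const_one,
      one_mul]
  simp only [h1]
  rw [Finset.sum_prod_piFinset]
  simp only [sum_pair_IZ_sign]
  rw [Fintype.prod_ite_zero, Finset.prod_const, Finset.card_univ, Fintype.card_fin]
  by_cases h : ∀ j : Fin m, T (Fin.natAdd n j) = Pauli.I ∨ T (Fin.natAdd n j) = Pauli.Z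
  · rw [if_pos h, if_pos h]
  · rw [if_neg h, if_neg h]


end Kernel

section Tensor

/-! ### Source Tensor — helper file 3/5: data/ancilla factorisation of Pauli expectations

Original module docstring:

# Route SymplecticPurity · item SymplecticPurityBound — data ⊗ ancilla factorisation (helper file 3/5)

For `χ = ψ ⊗ |0^m⟩` (`tensorVec ψ (zeroState m)`, data wires first) and a Pauli string `T` on
`n + m` wires, `⟨χ|σ_T|χ⟩ = ⟨ψ|σ_{T|data}|ψ⟩ · ⟨0^m|σ_{T|anc}|0^m⟩`, and the ancilla factor is `1`
if `T` is diagonal (`I`/`Z`) on every ancilla wire and `0` otherwise. Consequently, for a unit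
`ε`-flat `ψ` (all non-identity Pauli expectations at most `ε` in modulus),
`|⟨χ|σ_T|χ⟩|² ≤ [T ∈ I^n ⊗ {I,Z}^m] + ε² [T|anc ∈ {I,Z}^m]`, and summing over any family of strings
bounds its spectral mass by two label counts.
-/


/-- The expectation `⟨v|σ_S|v⟩` as a double sum over labels (register form). [folklore] -/
private theorem exp_eq_sum_prod {k : ℕ} (v : (Fin k → Bool) → ℂ) (S : Fin k → Pauli) :
    star v ⬝ᵥ (pauliString S *ᵥ v) =
      ∑ p : (Fin k → Bool) × (Fin k → Bool), star (v p.1) * (pauliString S p.1 p.2 * v p.2) := by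
  rw [Fintype.sum_prod_type]
  simp only [dotProduct, Matrix.mulVec, Pi.star_apply, Finset.mul_sum]

/-- **Factorisation of Pauli expectations on a product vector**:
`⟨ψ ⊗ ζ| σ_T |ψ ⊗ ζ⟩ = ⟨ψ|σ_{T|data}|ψ⟩ · ⟨ζ|σ_{T|anc}|ζ⟩` (data wires `castAdd`, ancilla wires
`natAdd`).
[folklore] -/
private theorem exp_tensorVec (n m : ℕ) (ψ : (Fin n → Bool) → ℂ) (ζ : (Fin m → Bool) → ℂ)
    (T : Fin (n + m) → Pauli) :
    star (tensorVec ψ ζ) ⬝ᵥ (pauliString T *ᵥ tensorVec ψ ζ) =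
      (star ψ ⬝ᵥ (pauliString (fun i => T (Fin.castAdd m i)) *ᵥ ψ)) *
        (star ζ ⬝ᵥ (pauliString (fun j => T (Fin.natAdd n j)) *ᵥ ζ)) := by
  rw [exp_eq_sum_prod, exp_eq_sum_prod, exp_eq_sum_prod, Finset.sum_mul_sum]
  have happ : ∀ (a : Fin n → Bool) (b : Fin m → Bool),
      tensorVec ψ ζ (Fin.append a b) = ψ a * ζ b := by
    intro a b
    simp only [tensorVec, Fin.append_left, Fin.append_right]
  have hσ : ∀ (a a' : Fin n → Bool) (b b' : Fin m → Bool),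
      pauliString T (Fin.append a b) (Fin.append a' b') =
        pauliString (fun i => T (Fin.castAdd m i)) a a' *
          pauliString (fun j => T (Fin.natAdd n j)) b b' := by
    intro a a' b b'
    simp only [pauliString_eq, tensorAll_apply]
    rw [Fin.prod_univ_add]
    simp only [Fin.append_left, Fin.append_right]
  rw [← Fintype.sum_equiv ((Fin.appendEquiv n m).prodCongr (Fin.appendEquiv n m))
    (fun i => star (tensorVec ψ ζ (Fin.append i.1.1 i.1.2)) *
      (pauliString T (Fin.append i.1.1 i.1.2) (Fin.append i.2.1 i.2.2) *
        tensorVec ψ ζ (Fin.append i.2.1 i.2.2)))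
    _ (fun _ => rfl)]
  simp only [happ, hσ]
  simp only [Fintype.sum_prod_type]
  refine Finset.sum_congr rfl fun a _ => ?_
  rw [Finset.sum_comm]
  refine Finset.sum_congr rfl fun a' _ => Finset.sum_congr rfl fun b _ =>
    Finset.sum_congr rfl fun b' _ => ?_
  simp only [star_mul']
  ring

/-- Diagonal entry `⟨0|σ_q|0⟩` of a one-qubit Pauli: `1` for `I, Z` and `0` for `X, Y`. [folklore] -/
private theorem pauli_mat_false_false (q : Pauli) :
    Pauli.mat q false false = if q = Pauli.I ∨ q = Pauli.Z then 1 else 0 := by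
  cases q <;> simp

/-- **Ancilla factor**: `⟨0^m|σ_R|0^m⟩ = 1` if every letter of `R` is `I` or `Z`, else `0`. [folklore] -/
private theorem exp_zeroState (m : ℕ) (R : Fin m → Pauli) :
    star (zeroState m) ⬝ᵥ (pauliString R *ᵥ zeroState m) =
      if ∀ j, R j = Pauli.I ∨ R j = Pauli.Z then 1 else 0 := by
  have h0 : star (zeroState m) ⬝ᵥ (pauliString R *ᵥ zeroState m) =
      pauliString R (fun _ => false) (fun _ => false) := by
    simp only [dotProduct, Matrix.mulVec, Pi.star_apply, zeroState, basisState_apply,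
      apply_ite star, star_one, star_zero, ite_mul, one_mul, zero_mul, mul_ite, mul_one,
      mul_zero, Finset.sum_ite_eq', Finset.mem_univ, if_true]
  rw [h0]
  simp only [pauliString_eq, tensorAll_apply, pauli_mat_false_false]
  rw [Fintype.prod_ite_zero, Finset.prod_const_one]
  by_cases h : ∀ j, R j = Pauli.I ∨ R j = Pauli.Z
  · rw [if_pos h, if_pos h]
  · rw [if_neg h, if_neg h]

/-- `⟨v|v⟩ = normSq v` (as a complex number). [folklore] -/
private theorem star_dotProduct_self {k : ℕ} (v : (Fin k → Bool) → ℂ) :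
    star v ⬝ᵥ v = ((normSq v : ℝ) : ℂ) := by
  simp only [dotProduct, Pi.star_apply, normSq]
  push_cast
  exact Finset.sum_congr rfl fun x _ => by rw [Complex.star_def, Complex.conj_mul']

/-- `‖ψ ⊗ ζ‖² = ‖ψ‖² ‖ζ‖²`. [folklore] -/
private theorem normSq_tensorVec {n m : ℕ} (ψ : (Fin n → Bool) → ℂ) (ζ : (Fin m → Bool) → ℂ) :
    normSq (tensorVec ψ ζ) = normSq ψ * normSq ζ := by
  simp only [normSq]
  rw [← Fintype.sum_equiv (Fin.appendEquiv n m)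
    (fun ab => ‖tensorVec ψ ζ (Fin.append ab.1 ab.2)‖ ^ 2) _ (fun _ => rfl),
    Fintype.sum_prod_type, Finset.sum_mul_sum]
  refine Finset.sum_congr rfl fun a _ => Finset.sum_congr rfl fun b _ => ?_
  simp only [tensorVec, Fin.append_left, Fin.append_right, norm_mul, mul_pow]

/-- `ψ ⊗ |0^m⟩` is a unit vector when `ψ` is. [folklore] -/
private theorem normSq_tensorVec_zeroState {n : ℕ} (m : ℕ) {ψ : (Fin n → Bool) → ℂ} (hψ : normSq ψ = 1) :
    normSq (tensorVec ψ (zeroState m)) = 1 := by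
  rw [normSq_tensorVec, hψ, zeroState, normSq_basisState, one_mul]

/-- **Single-string bound**: for a unit `ε`-flat `ψ`, the squared expectation of `σ_T` in
`ψ ⊗ |0^m⟩` is at most `[T ∈ I^n ⊗ {I,Z}^m] + ε² [T|anc ∈ {I,Z}^m]`.
[folklore] -/
private theorem norm_exp_tensorVec_zeroState_sq_le {n : ℕ} (m : ℕ) (ε : ℝ) {ψ : (Fin n → Bool) → ℂ}
    (hψ : normSq ψ = 1)
    (hflat : ∀ S : Fin n → Pauli, S ≠ (fun _ => Pauli.I) →
      ‖star ψ ⬝ᵥ (pauliString S *ᵥ ψ)‖ ≤ ε)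
    (T : Fin (n + m) → Pauli) :
    ‖star (tensorVec ψ (zeroState m)) ⬝ᵥ (pauliString T *ᵥ tensorVec ψ (zeroState m))‖ ^ 2 ≤
      (if (∀ i : Fin n, T (Fin.castAdd m i) = Pauli.I) ∧
            (∀ j : Fin m, T (Fin.natAdd n j) = Pauli.I ∨ T (Fin.natAdd n j) = Pauli.Z)
        then (1 : ℝ) else 0) +
      (if ∀ j : Fin m, T (Fin.natAdd n j) = Pauli.I ∨ T (Fin.natAdd n j) = Pauli.Z
        then ε ^ 2 else 0) := by
  rw [exp_tensorVec, exp_zeroState]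
  by_cases hanc : ∀ j : Fin m, T (Fin.natAdd n j) = Pauli.I ∨ T (Fin.natAdd n j) = Pauli.Z
  · rw [if_pos hanc, if_pos hanc, mul_one]
    by_cases hdat : ∀ i : Fin n, T (Fin.castAdd m i) = Pauli.I
    · rw [if_pos ⟨hdat, hanc⟩]
      have hI : (fun i => T (Fin.castAdd m i)) = fun _ => Pauli.I := funext hdat
      rw [hI, pauliString_const_I, Matrix.one_mulVec, star_dotProduct_self, hψ]
      simp only [Complex.ofReal_one, norm_one, one_pow]
      nlinarith [sq_nonneg ε]
    · rw [if_neg (fun h => hdat h.1), zero_add]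
      have hne : (fun i => T (Fin.castAdd m i)) ≠ fun _ => Pauli.I :=
        fun h => hdat (fun i => congrFun h i)
      have h := hflat _ hne
      have h0 : 0 ≤ ‖star ψ ⬝ᵥ (pauliString (fun i => T (Fin.castAdd m i)) *ᵥ ψ)‖ :=
        norm_nonneg _
      nlinarith
  · rw [if_neg hanc, if_neg hanc, if_neg (fun h => hanc h.2), mul_zero, norm_zero, add_zero]
    norm_num

/-- **Spectral mass of a family of strings**: summing the single-string bound over any finite
family `M`, `Σ_{T ∈ M} |⟨χ|σ_T|χ⟩|² ≤ #{T ∈ M : T ∈ I^n ⊗ {I,Z}^m} + ε² · #{T ∈ M : T|anc ∈ {I,Z}^m}`.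
[folklore] -/
private theorem sum_norm_exp_sq_le_card_add {n : ℕ} (m : ℕ) (ε : ℝ) {ψ : (Fin n → Bool) → ℂ}
    (hψ : normSq ψ = 1)
    (hflat : ∀ S : Fin n → Pauli, S ≠ (fun _ => Pauli.I) →
      ‖star ψ ⬝ᵥ (pauliString S *ᵥ ψ)‖ ≤ ε)
    (M : Finset (Fin (n + m) → Pauli)) :
    ∑ T ∈ M, ‖star (tensorVec ψ (zeroState m)) ⬝ᵥ
        (pauliString T *ᵥ tensorVec ψ (zeroState m))‖ ^ 2 ≤
      ((M.filter fun T => (∀ i : Fin n, T (Fin.castAdd m i) = Pauli.I) ∧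
          (∀ j : Fin m, T (Fin.natAdd n j) = Pauli.I ∨ T (Fin.natAdd n j) = Pauli.Z)).card : ℝ) +
      ε ^ 2 * ((M.filter fun T =>
          ∀ j : Fin m, T (Fin.natAdd n j) = Pauli.I ∨ T (Fin.natAdd n j) = Pauli.Z).card : ℝ) := by
  refine (Finset.sum_le_sum fun T _ => norm_exp_tensorVec_zeroState_sq_le m ε hψ hflat T).trans ?_
  rw [Finset.sum_add_distrib, Finset.sum_boole]
  simp only [← mul_boole _ (ε ^ 2)]
  rw [← Finset.mul_sum, Finset.sum_boole]


end Tensor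

section Counting

/-! ### Source Counting — helper file 4/5: the stabilizer counting (duality, isotropy) and the cut bound

Original module docstring:

# Route SymplecticPurity · item SymplecticPurityBound — the stabilizer counting (helper file 4/5)

Fix a semantic Clifford unitary `U` on `n + m` wires with label map `f` (`U σ_S U† = c(S) σ_{f S}`),
and for a wire set `A` put (all as plain expressions, no definitions)

* `a(A) = #{R ∈ {I,Z}^m : f(I^n ⊗ R) ∈ 𝒫_A}` — the stabilizers of `U(· ⊗ |0^m⟩)` supported in `A`;
* `b(A) = #{T : f T ∈ 𝒫_A, T|anc ∈ {I,Z}^m}`.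

We prove the two counting facts of the purity bound:

* **(ii) duality** `2^m · b(A) = 4^{|A|} · a(Aᶜ)` — by evaluating the double character sum
  `Σ_{f T ∈ 𝒫_A} Σ_{z ∈ I^n⊗{I,Z}^m} sgn(T,z)` in the two orders (the inner sums are the product
  formulas of the Kernel file; `f` enters only through bijectivity and sign preservation);
* **(i) isotropy** `a(A) · a(Aᶜ) ≤ 2^m` — `(R, R') ↦ R·R'` is injective on the pairs counted,
  because `f(z z') = f(z) f(z')` has `f z` on `A` and `f z'` off `A`;

and combine them with the spectral-mass identity and the data/ancilla factorisation into the
**cut bound** `Tr ρ_A² ≤ u + ε²/u`, `u = a(A)/2^{|A|}`.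
-/


variable {n m : ℕ} {U : Matrix (Fin (n + m) → Bool) (Fin (n + m) → Bool) ℂ}
  {f : (Fin (n + m) → Pauli) → (Fin (n + m) → Pauli)} {c : (Fin (n + m) → Pauli) → ℂ}

/-! ## The embedded diagonal strings `I^n ⊗ R` -/

/-- Letters of a member of `{I,Z}^m`. [folklore] -/
private theorem letter_of_mem_piFinset_IZ {R : Fin m → Pauli}
    (hR : R ∈ Fintype.piFinset (fun _ : Fin m => ({Pauli.I, Pauli.Z} : Finset Pauli))) (j : Fin m) :
    R j = Pauli.I ∨ R j = Pauli.Z := by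
  have h := Fintype.mem_piFinset.1 hR j
  simpa only [Finset.mem_insert, Finset.mem_singleton] using h

/-- Membership in `{I,Z}^m` from the letters. [folklore] -/
private theorem mem_piFinset_IZ_of_letter {R : Fin m → Pauli} (hR : ∀ j, R j = Pauli.I ∨ R j = Pauli.Z) :
    R ∈ Fintype.piFinset (fun _ : Fin m => ({Pauli.I, Pauli.Z} : Finset Pauli)) := by
  rw [Fintype.mem_piFinset]
  intro j
  simpa only [Finset.mem_insert, Finset.mem_singleton] using hR j

/-- The letters of `I^n ⊗ R` are diagonal when those of `R` are. [folklore] -/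
private theorem append_I_letter {R : Fin m → Pauli} (hR : ∀ j, R j = Pauli.I ∨ R j = Pauli.Z)
    (i : Fin (n + m)) :
    Fin.append (fun _ : Fin n => Pauli.I) R i = Pauli.I ∨
      Fin.append (fun _ : Fin n => Pauli.I) R i = Pauli.Z := by
  refine Fin.addCases (fun i => ?_) (fun j => ?_) i
  · left; rw [Fin.append_left]
  · rw [Fin.append_right]; exact hR j

/-- `I^n ⊗ I^m = I^{n+m}`. [folklore] -/
private theorem append_I_I : Fin.append (fun _ : Fin n => Pauli.I) (fun _ : Fin m => Pauli.I) =
    fun _ => Pauli.I := by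
  funext i
  refine Fin.addCases (fun i => ?_) (fun j => ?_) i
  · rw [Fin.append_left]
  · rw [Fin.append_right]

/-- `R ↦ I^n ⊗ R` is injective. [folklore] -/
private theorem append_I_injective : Function.Injective
    (fun R : Fin m → Pauli => Fin.append (fun _ : Fin n => Pauli.I) R) := by
  intro R R' h
  funext j
  have := congrFun h (Fin.natAdd n j)
  simpa only [Fin.append_right] using this

/-- `#{I,Z}^m = 2^m`. [folklore] -/
private theorem card_piFinset_IZ :
    (Fintype.piFinset (fun _ : Fin m => ({Pauli.I, Pauli.Z} : Finset Pauli))).card = 2 ^ m := by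
  rw [Fintype.card_piFinset, Finset.prod_const, Finset.card_univ, Fintype.card_fin,
    Finset.card_pair (by decide)]

/-! ## Linking the two descriptions of the stabilizer count -/

/-- The strings `T` with `f T ∈ 𝒫_A`, identity data part and diagonal ancilla part are exactly the
`I^n ⊗ R` with `R ∈ {I,Z}^m` and `f(I^n ⊗ R) ∈ 𝒫_A`; in particular the two counts agree.
[folklore] -/
private theorem card_filter_data_anc_eq (A : Finset (Fin (n + m))) :
    ((Finset.univ.filter fun T : Fin (n + m) → Pauli => f T ∈ stringsOn A).filter fun T =>
        (∀ i : Fin n, T (Fin.castAdd m i) = Pauli.I) ∧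
          (∀ j : Fin m, T (Fin.natAdd n j) = Pauli.I ∨ T (Fin.natAdd n j) = Pauli.Z)).card =
      ((Fintype.piFinset (fun _ : Fin m => ({Pauli.I, Pauli.Z} : Finset Pauli))).filter fun R =>
        f (Fin.append (fun _ : Fin n => Pauli.I) R) ∈ stringsOn A).card := by
  symm
  refine Finset.card_bij (fun R _ => Fin.append (fun _ : Fin n => Pauli.I) R) ?_ ?_ ?_
  · intro R hR
    rw [Finset.mem_filter] at hR
    simp only [Finset.mem_filter, Finset.mem_univ, true_and, Fin.append_left, Fin.append_right]
    exact ⟨hR.2, fun _ => trivial, letter_of_mem_piFinset_IZ hR.1⟩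
  · intro R₁ _ R₂ _ h
    exact append_I_injective h
  · intro T hT
    simp only [Finset.mem_filter, Finset.mem_univ, true_and] at hT
    refine ⟨fun j => T (Fin.natAdd n j), ?_, ?_⟩
    · rw [Finset.mem_filter]
      have hT' : Fin.append (fun _ : Fin n => Pauli.I) (fun j => T (Fin.natAdd n j)) = T := by
        conv_rhs => rw [← Fin.append_castAdd_natAdd (f := T)]
        congr 1
        funext i
        exact (hT.2.1 i).symm
      refine ⟨mem_piFinset_IZ_of_letter hT.2.2, ?_⟩
      rw [hT']
      exact hT.1
    · conv_rhs => rw [← Fin.append_castAdd_natAdd (f := T)]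
      congr 1
      funext i
      exact (hT.2.1 i).symm

/-! ## (ii) Duality by double counting -/

/-- **Duality count**: `2^m · b(A) = 4^{|A|} · a(Aᶜ)`. [folklore] -/
private theorem two_pow_mul_card_anc_eq (hU : Uᴴ * U = 1)
    (hf : ∀ S, ‖c S‖ = 1 ∧ U * pauliString S * Uᴴ = c S • pauliString (f S))
    (A : Finset (Fin (n + m))) :
    2 ^ m * ((Finset.univ.filter fun T : Fin (n + m) → Pauli => f T ∈ stringsOn A).filter fun T =>
        ∀ j : Fin m, T (Fin.natAdd n j) = Pauli.I ∨ T (Fin.natAdd n j) = Pauli.Z).card =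
      4 ^ A.card * ((Fintype.piFinset (fun _ : Fin m => ({Pauli.I, Pauli.Z} : Finset Pauli))).filter
        fun R => f (Fin.append (fun _ : Fin n => Pauli.I) R) ∈ stringsOn Aᶜ).card := by
  -- the double character sum, evaluated in the two orders
  set D : ℂ := ∑ T ∈ Finset.univ.filter (fun T : Fin (n + m) → Pauli => f T ∈ stringsOn A),
    ∑ R ∈ Fintype.piFinset (fun _ : Fin m => ({Pauli.I, Pauli.Z} : Finset Pauli)),
      ∏ i, Pauli.sign (T i) (Fin.append (fun _ : Fin n => Pauli.I) R i) with hD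
  -- first order: inner sum over the diagonal strings
  have h1 : D = 2 ^ m * (((Finset.univ.filter fun T : Fin (n + m) → Pauli =>
      f T ∈ stringsOn A).filter fun T =>
        ∀ j : Fin m, T (Fin.natAdd n j) = Pauli.I ∨ T (Fin.natAdd n j) = Pauli.Z).card : ℂ) := by
    rw [hD]
    simp only [sum_piFinset_IZ_prod_sign]
    rw [← Finset.sum_filter, Finset.sum_const, nsmul_eq_mul, mul_comm]
  -- second order: inner sum over `f⁻¹(𝒫_A)`, transported along `f`
  have h2 : D = 4 ^ A.card * (((Fintype.piFinset
      (fun _ : Fin m => ({Pauli.I, Pauli.Z} : Finset Pauli))).filter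
        fun R => f (Fin.append (fun _ : Fin n => Pauli.I) R) ∈ stringsOn Aᶜ).card : ℂ) := by
    rw [hD, Finset.sum_comm]
    have inner : ∀ R : Fin m → Pauli,
        ∑ T ∈ Finset.univ.filter (fun T : Fin (n + m) → Pauli => f T ∈ stringsOn A),
          ∏ i, Pauli.sign (T i) (Fin.append (fun _ : Fin n => Pauli.I) R i) =
        if f (Fin.append (fun _ : Fin n => Pauli.I) R) ∈ stringsOn Aᶜ then (4 : ℂ) ^ A.card
        else 0 := by
      intro R
      have hs : ∀ T : Fin (n + m) → Pauli,
          ∏ i, Pauli.sign (T i) (Fin.append (fun _ : Fin n => Pauli.I) R i) =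
            ∏ i, Pauli.sign (f T i) (f (Fin.append (fun _ : Fin n => Pauli.I) R) i) :=
        fun T => (clifford_sign hU hf T _).symm
      simp only [hs]
      rw [sum_filter_comp_clifford hU hf (stringsOn A)
        (fun Q => ∏ i, Pauli.sign (Q i) (f (Fin.append (fun _ : Fin n => Pauli.I) R) i)),
        sum_stringsOn_prod_sign]
      have hiff : (∀ i ∈ A, f (Fin.append (fun _ : Fin n => Pauli.I) R) i = Pauli.I) ↔
          f (Fin.append (fun _ : Fin n => Pauli.I) R) ∈ stringsOn Aᶜ := by
        rw [mem_stringsOn]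
        refine forall_congr' fun i => ?_
        rw [Finset.mem_compl, not_not]
      by_cases h : ∀ i ∈ A, f (Fin.append (fun _ : Fin n => Pauli.I) R) i = Pauli.I
      · rw [if_pos h, if_pos (hiff.1 h)]
      · rw [if_neg h, if_neg (fun h' => h (hiff.2 h'))]
    simp only [inner]
    rw [← Finset.sum_filter, Finset.sum_const, nsmul_eq_mul, mul_comm]
  have h12 := h1.symm.trans h2
  exact_mod_cast h12

/-! ## (i) Isotropy by an injection -/

/-- **Isotropy count**: `a(A) · a(Aᶜ) ≤ 2^m`. [folklore] -/
private theorem card_mul_card_compl_le (hU : Uᴴ * U = 1)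
    (hf : ∀ S, ‖c S‖ = 1 ∧ U * pauliString S * Uᴴ = c S • pauliString (f S))
    (A : Finset (Fin (n + m))) :
    ((Fintype.piFinset (fun _ : Fin m => ({Pauli.I, Pauli.Z} : Finset Pauli))).filter
        fun R => f (Fin.append (fun _ : Fin n => Pauli.I) R) ∈ stringsOn A).card *
      ((Fintype.piFinset (fun _ : Fin m => ({Pauli.I, Pauli.Z} : Finset Pauli))).filter
        fun R => f (Fin.append (fun _ : Fin n => Pauli.I) R) ∈ stringsOn Aᶜ).card ≤ 2 ^ m := by
  rw [← Finset.card_product, ← card_piFinset_IZ (m := m)]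
  refine Finset.card_le_card_of_injOn (fun p j => if p.1 j = p.2 j then Pauli.I else Pauli.Z)
    ?_ ?_
  · intro p _
    simp only [Finset.mem_coe]
    exact mem_piFinset_IZ_of_letter fun j => by by_cases h : p.1 j = p.2 j <;> simp [h]
  · rintro ⟨R₁, R₁'⟩ h₁ ⟨R₂, R₂'⟩ h₂ h
    simp only [Finset.coe_product, Set.mem_prod, Finset.mem_coe, Finset.mem_filter] at h₁ h₂
    -- embedded versions
    have hz : ∀ {R : Fin m → Pauli},
        R ∈ Fintype.piFinset (fun _ : Fin m => ({Pauli.I, Pauli.Z} : Finset Pauli)) →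
        ∀ i, Fin.append (fun _ : Fin n => Pauli.I) R i = Pauli.I ∨
          Fin.append (fun _ : Fin n => Pauli.I) R i = Pauli.Z :=
      fun hR => append_I_letter (letter_of_mem_piFinset_IZ hR)
    have hmerge : ∀ R R' : Fin m → Pauli,
        (fun i => if Fin.append (fun _ : Fin n => Pauli.I) R i =
            Fin.append (fun _ : Fin n => Pauli.I) R' i then Pauli.I else Pauli.Z) =
          Fin.append (fun _ : Fin n => Pauli.I) (fun j => if R j = R' j then Pauli.I else Pauli.Z) := by
      intro R R'
      funext i
      refine Fin.addCases (fun i => ?_) (fun j => ?_) i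
      · simp only [Fin.append_left, if_true]
      · simp only [Fin.append_right]
    have key₁ := clifford_map_mul_of_IZ hU hf (hz h₁.1.1) (hz h₁.2.1) h₁.1.2 h₁.2.2
    have key₂ := clifford_map_mul_of_IZ hU hf (hz h₂.1.1) (hz h₂.2.1) h₂.1.2 h₂.2.2
    rw [hmerge] at key₁ key₂
    have hRR : (fun j => if R₁ j = R₁' j then Pauli.I else Pauli.Z) =
        fun j => if R₂ j = R₂' j then Pauli.I else Pauli.Z := h
    rw [hRR, key₂] at key₁
    -- key₁ : merge of (f z₂, f z₂') = merge of (f z₁, f z₁')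
    have hinj := clifford_injective hU hf
    have e1 : f (Fin.append (fun _ : Fin n => Pauli.I) R₁) =
        f (Fin.append (fun _ : Fin n => Pauli.I) R₂) := by
      funext i
      by_cases hi : i ∈ A
      · have := congrFun key₁ i
        simp only [hi, if_true] at this
        exact this.symm
      · rw [mem_stringsOn.1 h₁.1.2 i hi, mem_stringsOn.1 h₂.1.2 i hi]
    have e2 : f (Fin.append (fun _ : Fin n => Pauli.I) R₁') =
        f (Fin.append (fun _ : Fin n => Pauli.I) R₂') := by
      funext i
      by_cases hi : i ∈ A
      · have hi' : i ∉ Aᶜ := fun h => (Finset.mem_compl.1 h) hi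
        rw [mem_stringsOn.1 h₁.2.2 i hi', mem_stringsOn.1 h₂.2.2 i hi']
      · have := congrFun key₁ i
        simp only [hi, if_false] at this
        exact this.symm
    have r1 := append_I_injective (hinj e1)
    have r2 := append_I_injective (hinj e2)
    rw [r1, r2]

/-! ## The cut bound -/

/-- `a(A) ≥ 1`: the identity is a stabilizer supported everywhere. [folklore] -/
private theorem one_le_card_stab (hU' : U * Uᴴ = 1)
    (hf : ∀ S, ‖c S‖ = 1 ∧ U * pauliString S * Uᴴ = c S • pauliString (f S))
    (A : Finset (Fin (n + m))) :
    1 ≤ ((Fintype.piFinset (fun _ : Fin m => ({Pauli.I, Pauli.Z} : Finset Pauli))).filter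
        fun R => f (Fin.append (fun _ : Fin n => Pauli.I) R) ∈ stringsOn A).card := by
  rw [Nat.one_le_iff_ne_zero, Ne, Finset.card_eq_zero, ← Ne, ← Finset.nonempty_iff_ne_empty]
  refine ⟨fun _ => Pauli.I, ?_⟩
  rw [Finset.mem_filter]
  refine ⟨mem_piFinset_IZ_of_letter fun _ => Or.inl rfl, ?_⟩
  rw [append_I_I, clifford_map_I hU' hf]
  exact mem_stringsOn.2 fun _ _ => rfl

/-- **The cut bound**: for a unit `ε`-flat `ψ`, a semantic Clifford unitary `U` and a wire set
`A`, the purity `Tr ρ_A²` of `U(ψ ⊗ |0^m⟩)` (four-fold agreement sum) is at most `u + ε²/u` with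
`u = a(A)/2^{|A|}`.
[folklore] -/
private theorem fourFold_le_stab (hU : Uᴴ * U = 1) (hU' : U * Uᴴ = 1)
    (hf : ∀ S, ‖c S‖ = 1 ∧ U * pauliString S * Uᴴ = c S • pauliString (f S))
    (ε : ℝ) {ψ : (Fin n → Bool) → ℂ} (hψ : normSq ψ = 1)
    (hflat : ∀ S : Fin n → Pauli, S ≠ (fun _ => Pauli.I) →
      ‖star ψ ⬝ᵥ (pauliString S *ᵥ ψ)‖ ≤ ε)
    (A : Finset (Fin (n + m)))
    [D : ∀ x₁ x₂ x₃ x₄ : Fin (n + m) → Bool, Decidable ((∀ i ∉ A, x₁ i = x₂ i) ∧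
      (∀ i ∈ A, x₂ i = x₃ i) ∧ (∀ i ∉ A, x₃ i = x₄ i) ∧ (∀ i ∈ A, x₄ i = x₁ i))] :
    ‖∑ x₁ : Fin (n + m) → Bool, ∑ x₂ : Fin (n + m) → Bool, ∑ x₃ : Fin (n + m) → Bool,
        ∑ x₄ : Fin (n + m) → Bool,
        (if (∀ i ∉ A, x₁ i = x₂ i) ∧ (∀ i ∈ A, x₂ i = x₃ i) ∧ (∀ i ∉ A, x₃ i = x₄ i) ∧
            (∀ i ∈ A, x₄ i = x₁ i)
         then (U *ᵥ tensorVec ψ (zeroState m)) x₁ * star ((U *ᵥ tensorVec ψ (zeroState m)) x₂) *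
           (U *ᵥ tensorVec ψ (zeroState m)) x₃ * star ((U *ᵥ tensorVec ψ (zeroState m)) x₄)
         else 0)‖ ≤
      (((Fintype.piFinset (fun _ : Fin m => ({Pauli.I, Pauli.Z} : Finset Pauli))).filter
          fun R => f (Fin.append (fun _ : Fin n => Pauli.I) R) ∈ stringsOn A).card : ℝ) / 2 ^ A.card +
      ε ^ 2 * (2 ^ A.card / ((Fintype.piFinset (fun _ : Fin m => ({Pauli.I, Pauli.Z} : Finset Pauli))).filter
          fun R => f (Fin.append (fun _ : Fin n => Pauli.I) R) ∈ stringsOn A).card) := by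
  -- abbreviations
  set a : ℕ := ((Fintype.piFinset (fun _ : Fin m => ({Pauli.I, Pauli.Z} : Finset Pauli))).filter
    fun R => f (Fin.append (fun _ : Fin n => Pauli.I) R) ∈ stringsOn A).card with ha
  set a' : ℕ := ((Fintype.piFinset (fun _ : Fin m => ({Pauli.I, Pauli.Z} : Finset Pauli))).filter
    fun R => f (Fin.append (fun _ : Fin n => Pauli.I) R) ∈ stringsOn Aᶜ).card with ha'
  set b : ℕ := ((Finset.univ.filter fun T : Fin (n + m) → Pauli => f T ∈ stringsOn A).filter
    fun T => ∀ j : Fin m, T (Fin.natAdd n j) = Pauli.I ∨ T (Fin.natAdd n j) = Pauli.Z).card with hb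
  have hii : 2 ^ m * b = 4 ^ A.card * a' := two_pow_mul_card_anc_eq hU hf A
  have hi : a * a' ≤ 2 ^ m := card_mul_card_compl_le hU hf A
  have ha1 : 1 ≤ a := one_le_card_stab hU' hf A
  -- the spectral mass
  rw [fourFold_eq_spectralMass, Complex.norm_real, Real.norm_eq_abs, abs_of_nonneg
    (mul_nonneg (inv_nonneg.2 (pow_nonneg two_pos.le _))
      (Finset.sum_nonneg fun _ _ => sq_nonneg _)),
    sum_stringsOn_norm_exp_sq_clifford hU hf]
  have hmass := sum_norm_exp_sq_le_card_add m ε hψ hflat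
    (Finset.univ.filter fun T : Fin (n + m) → Pauli => f T ∈ stringsOn A)
  rw [card_filter_data_anc_eq A] at hmass
  -- numerics
  have h2k : (0 : ℝ) < 2 ^ A.card := pow_pos two_pos _
  have h2m : (0 : ℝ) < 2 ^ m := pow_pos two_pos _
  have haR : (1 : ℝ) ≤ a := by exact_mod_cast ha1
  have hiiR : (2 : ℝ) ^ m * b = 4 ^ A.card * a' := by exact_mod_cast hii
  have hiR : (a : ℝ) * a' ≤ 2 ^ m := by exact_mod_cast hi
  have h4 : (4 : ℝ) ^ A.card = 2 ^ A.card * 2 ^ A.card := by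
    rw [← mul_pow]; norm_num
  -- b ≤ 4^k a'/2^m ≤ 4^k / a
  have hbR : (b : ℝ) ≤ 2 ^ A.card * 2 ^ A.card / a := by
    rw [le_div_iff₀ (by linarith), ← h4]
    have : (b : ℝ) * a * 2 ^ m = 4 ^ A.card * (a' * a) := by
      calc (b : ℝ) * a * 2 ^ m = (2 ^ m * b) * a := by ring
        _ = 4 ^ A.card * a' * a := by rw [hiiR]
        _ = 4 ^ A.card * (a' * a) := by ring
    have h4pos : (0 : ℝ) < 4 ^ A.card := pow_pos (by norm_num) _
    nlinarith [this, hiR, h4pos]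
  calc (2 ^ A.card)⁻¹ * ∑ T ∈ Finset.univ.filter (fun T : Fin (n + m) → Pauli => f T ∈ stringsOn A),
        ‖star (tensorVec ψ (zeroState m)) ⬝ᵥ (pauliString T *ᵥ tensorVec ψ (zeroState m))‖ ^ 2
      ≤ (2 ^ A.card)⁻¹ * ((a : ℝ) + ε ^ 2 * b) := by
        exact mul_le_mul_of_nonneg_left hmass (inv_nonneg.2 h2k.le)
    _ ≤ (2 ^ A.card)⁻¹ * ((a : ℝ) + ε ^ 2 * (2 ^ A.card * 2 ^ A.card / a)) := by
        gcongr
    _ = (a : ℝ) / 2 ^ A.card + ε ^ 2 * (2 ^ A.card / a) := by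
        field_simp


end Counting

section Main


/-! ## Linear cuts -/

/-- The four-fold sum written with the cut `k` (as on the route) is the four-fold sum of the wire
set `A_k = {i : i < k}`.
[folklore] -/
private theorem fourFold_cut_eq {N : ℕ} (k : ℕ) (φ : (Fin N → Bool) → ℂ)
    [D : ∀ x₁ x₂ x₃ x₄ : Fin N → Bool, Decidable ((∀ i : Fin N, k ≤ i.val → x₁ i = x₂ i) ∧
      (∀ i : Fin N, i.val < k → x₂ i = x₃ i) ∧ (∀ i : Fin N, k ≤ i.val → x₃ i = x₄ i) ∧
      (∀ i : Fin N, i.val < k → x₄ i = x₁ i))]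
    [D' : ∀ x₁ x₂ x₃ x₄ : Fin N → Bool, Decidable
      ((∀ i ∉ (Finset.univ.filter fun i : Fin N => i.val < k), x₁ i = x₂ i) ∧
      (∀ i ∈ (Finset.univ.filter fun i : Fin N => i.val < k), x₂ i = x₃ i) ∧
      (∀ i ∉ (Finset.univ.filter fun i : Fin N => i.val < k), x₃ i = x₄ i) ∧
      (∀ i ∈ (Finset.univ.filter fun i : Fin N => i.val < k), x₄ i = x₁ i))] :
    (∑ x₁ : Fin N → Bool, ∑ x₂ : Fin N → Bool, ∑ x₃ : Fin N → Bool, ∑ x₄ : Fin N → Bool,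
      (if (∀ i : Fin N, k ≤ i.val → x₁ i = x₂ i) ∧ (∀ i : Fin N, i.val < k → x₂ i = x₃ i) ∧
          (∀ i : Fin N, k ≤ i.val → x₃ i = x₄ i) ∧ (∀ i : Fin N, i.val < k → x₄ i = x₁ i)
       then φ x₁ * star (φ x₂) * φ x₃ * star (φ x₄) else 0)) =
    ∑ x₁ : Fin N → Bool, ∑ x₂ : Fin N → Bool, ∑ x₃ : Fin N → Bool, ∑ x₄ : Fin N → Bool,
      (if (∀ i ∉ (Finset.univ.filter fun i : Fin N => i.val < k), x₁ i = x₂ i) ∧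
          (∀ i ∈ (Finset.univ.filter fun i : Fin N => i.val < k), x₂ i = x₃ i) ∧
          (∀ i ∉ (Finset.univ.filter fun i : Fin N => i.val < k), x₃ i = x₄ i) ∧
          (∀ i ∈ (Finset.univ.filter fun i : Fin N => i.val < k), x₄ i = x₁ i)
       then φ x₁ * star (φ x₂) * φ x₃ * star (φ x₄) else 0) := by
  refine Finset.sum_congr rfl fun x₁ _ => Finset.sum_congr rfl fun x₂ _ =>
    Finset.sum_congr rfl fun x₃ _ => Finset.sum_congr rfl fun x₄ _ => if_congr ?_ rfl rfl
  simp only [Finset.mem_filter, Finset.mem_univ, true_and, not_lt]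

/-- At the empty cut `k = 0` the four-fold sum is `‖φ‖⁴`. [folklore] -/
private theorem fourFold_cut_zero {N : ℕ} (φ : (Fin N → Bool) → ℂ)
    [D : ∀ x₁ x₂ x₃ x₄ : Fin N → Bool, Decidable ((∀ i : Fin N, 0 ≤ i.val → x₁ i = x₂ i) ∧
      (∀ i : Fin N, i.val < 0 → x₂ i = x₃ i) ∧ (∀ i : Fin N, 0 ≤ i.val → x₃ i = x₄ i) ∧
      (∀ i : Fin N, i.val < 0 → x₄ i = x₁ i))] :
    (∑ x₁ : Fin N → Bool, ∑ x₂ : Fin N → Bool, ∑ x₃ : Fin N → Bool, ∑ x₄ : Fin N → Bool,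
      (if (∀ i : Fin N, 0 ≤ i.val → x₁ i = x₂ i) ∧ (∀ i : Fin N, i.val < 0 → x₂ i = x₃ i) ∧
          (∀ i : Fin N, 0 ≤ i.val → x₃ i = x₄ i) ∧ (∀ i : Fin N, i.val < 0 → x₄ i = x₁ i)
       then φ x₁ * star (φ x₂) * φ x₃ * star (φ x₄) else 0)) =
      (((∑ x, ‖φ x‖ ^ 2) ^ 2 : ℝ) : ℂ) := by
  classical
  rw [← fourFold_empty φ]
  refine Finset.sum_congr rfl fun x₁ _ => Finset.sum_congr rfl fun x₂ _ =>
    Finset.sum_congr rfl fun x₃ _ => Finset.sum_congr rfl fun x₄ _ => if_congr ?_ rfl rfl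
  simp only [Nat.zero_le, true_implies, Nat.not_lt_zero, false_implies, implies_true,
    Finset.notMem_empty, not_false_eq_true]

/-- At the full cut `k = N` the four-fold sum is `‖φ‖⁴`. [folklore] -/
private theorem fourFold_cut_top {N : ℕ} (φ : (Fin N → Bool) → ℂ)
    [D : ∀ x₁ x₂ x₃ x₄ : Fin N → Bool, Decidable ((∀ i : Fin N, N ≤ i.val → x₁ i = x₂ i) ∧
      (∀ i : Fin N, i.val < N → x₂ i = x₃ i) ∧ (∀ i : Fin N, N ≤ i.val → x₃ i = x₄ i) ∧
      (∀ i : Fin N, i.val < N → x₄ i = x₁ i))] :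
    (∑ x₁ : Fin N → Bool, ∑ x₂ : Fin N → Bool, ∑ x₃ : Fin N → Bool, ∑ x₄ : Fin N → Bool,
      (if (∀ i : Fin N, N ≤ i.val → x₁ i = x₂ i) ∧ (∀ i : Fin N, i.val < N → x₂ i = x₃ i) ∧
          (∀ i : Fin N, N ≤ i.val → x₃ i = x₄ i) ∧ (∀ i : Fin N, i.val < N → x₄ i = x₁ i)
       then φ x₁ * star (φ x₂) * φ x₃ * star (φ x₄) else 0)) =
      (((∑ x, ‖φ x‖ ^ 2) ^ 2 : ℝ) : ℂ) := by
  classical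
  rw [← fourFold_univ φ]
  refine Finset.sum_congr rfl fun x₁ _ => Finset.sum_congr rfl fun x₂ _ =>
    Finset.sum_congr rfl fun x₃ _ => Finset.sum_congr rfl fun x₄ _ => if_congr ?_ rfl rfl
  have h1 : ∀ i : Fin N, ¬ (N ≤ i.val) := fun i => not_le.2 i.isLt
  simp only [h1, false_implies, implies_true, Fin.is_lt, true_implies, Finset.mem_univ,
    not_true_eq_false, true_and]

/-! ## First passage of a halving-bounded sequence -/

/-- **Discrete first passage**: a monotone `a : ℕ → ℕ` with `a 0 = 1` and `a N / 2^N ≤ 2ε < 1`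
passes through the window `(ε, 2ε]`: some `k ≤ N` has `ε < a k / 2^k ≤ 2ε` (the ratios
`a k / 2^k` at consecutive indices differ by a factor at least `1/2`).
[folklore] -/
private theorem exists_first_passage (a : ℕ → ℕ) (hmono : ∀ k, a k ≤ a (k + 1)) (h0 : a 0 = 1) (N : ℕ)
    (ε : ℝ) (hε : 2 * ε < 1) (hN : (a N : ℝ) / 2 ^ N ≤ 2 * ε) :
    ∃ k ≤ N, ε < (a k : ℝ) / 2 ^ k ∧ (a k : ℝ) / 2 ^ k ≤ 2 * ε := by
  classical
  have hex : ∃ k, (a k : ℝ) / 2 ^ k ≤ 2 * ε := ⟨N, hN⟩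
  have hspec := Nat.find_spec hex
  have hle : Nat.find hex ≤ N := Nat.find_min' hex hN
  have hne : Nat.find hex ≠ 0 := by
    intro h
    rw [h, h0, pow_zero, Nat.cast_one, div_one] at hspec
    linarith
  obtain ⟨j, hj⟩ := Nat.exists_eq_succ_of_ne_zero hne
  have hnot : ¬ ((a j : ℝ) / 2 ^ j ≤ 2 * ε) := Nat.find_min hex (by omega)
  refine ⟨Nat.find hex, hle, ?_, hspec⟩
  rw [hj] at ⊢
  rw [not_le] at hnot
  have hmj : (a j : ℝ) ≤ a (j + 1) := by exact_mod_cast hmono j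
  have h2j : (0 : ℝ) < 2 ^ j := pow_pos two_pos _
  rw [lt_div_iff₀ (pow_pos two_pos _), pow_succ]
  rw [lt_div_iff₀ h2j] at hnot
  nlinarith

/-! ## The stabilizer count along the chain of linear cuts -/

variable {n m : ℕ} {U : Matrix (Fin (n + m) → Bool) (Fin (n + m) → Bool) ℂ}
  {f : (Fin (n + m) → Pauli) → (Fin (n + m) → Pauli)} {c : (Fin (n + m) → Pauli) → ℂ}

/-- The stabilizer count `a_k` is monotone along the chain `A_k = {i < k}`. [folklore] -/
private theorem card_stab_mono (k : ℕ) :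
    ((Fintype.piFinset (fun _ : Fin m => ({Pauli.I, Pauli.Z} : Finset Pauli))).filter
        fun R => f (Fin.append (fun _ : Fin n => Pauli.I) R) ∈
          stringsOn (Finset.univ.filter fun i : Fin (n + m) => i.val < k)).card ≤
    ((Fintype.piFinset (fun _ : Fin m => ({Pauli.I, Pauli.Z} : Finset Pauli))).filter
        fun R => f (Fin.append (fun _ : Fin n => Pauli.I) R) ∈
          stringsOn (Finset.univ.filter fun i : Fin (n + m) => i.val < k + 1)).card := by
  refine Finset.card_le_card fun R hR => ?_
  rw [Finset.mem_filter] at hR ⊢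
  refine ⟨hR.1, stringsOn_mono ?_ hR.2⟩
  intro i hi
  simp only [Finset.mem_filter, Finset.mem_univ, true_and] at hi ⊢
  omega

/-- `a_0 = 1`: only the identity label is a stabilizer supported in the empty cut. [folklore] -/
private theorem card_stab_zero (hU : Uᴴ * U = 1) (hU' : U * Uᴴ = 1)
    (hf : ∀ S, ‖c S‖ = 1 ∧ U * pauliString S * Uᴴ = c S • pauliString (f S)) :
    ((Fintype.piFinset (fun _ : Fin m => ({Pauli.I, Pauli.Z} : Finset Pauli))).filter
        fun R => f (Fin.append (fun _ : Fin n => Pauli.I) R) ∈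
          stringsOn (Finset.univ.filter fun i : Fin (n + m) => i.val < 0)).card = 1 := by
  have hA : (Finset.univ.filter fun i : Fin (n + m) => i.val < 0) = ∅ := by
    ext i; simp
  rw [hA, stringsOn_empty, Finset.card_eq_one]
  refine ⟨fun _ => Pauli.I, ?_⟩
  ext R
  simp only [Finset.mem_filter, Finset.mem_singleton]
  constructor
  · rintro ⟨-, h⟩
    rw [← clifford_map_I hU' hf] at h
    have h2 := clifford_injective hU hf h
    rw [← append_I_I (n := n) (m := m)] at h2
    exact append_I_injective h2
  · rintro rfl
    refine ⟨mem_piFinset_IZ_of_letter fun _ => Or.inl rfl, ?_⟩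
    rw [append_I_I, clifford_map_I hU' hf]

/-- `a_{n+m} = 2^m`: every diagonal ancilla label is a stabilizer supported in the full cut. [folklore] -/
private theorem card_stab_top :
    ((Fintype.piFinset (fun _ : Fin m => ({Pauli.I, Pauli.Z} : Finset Pauli))).filter
        fun R => f (Fin.append (fun _ : Fin n => Pauli.I) R) ∈
          stringsOn (Finset.univ.filter fun i : Fin (n + m) => i.val < n + m)).card = 2 ^ m := by
  have hA : (Finset.univ.filter fun i : Fin (n + m) => i.val < n + m) = Finset.univ :=
    Finset.filter_true_of_mem fun i _ => i.isLt
  rw [hA, stringsOn_univ, Finset.filter_true_of_mem fun R _ => Finset.mem_univ _, card_piFinset_IZ]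


end Main

end SymplecticPurityBound

/-! ### The named fact -/

open SymplecticPurityBound in

/-- **`symplecticPurityBound` — DISCHARGED** (entanglement you cannot rotate away): an `ε`-flat unit
vector on `n ≥ 1` qubits, padded with any number of `|0⟩` ancillas and rotated by any semantic Clifford
unitary, has a linear cut of purity at most `4ε`. [cite: AaronsonGottesman2004] -/
theorem symplecticPurityBound_holds : symplecticPurityBound := by
  unfold symplecticPurityBound
  intro n m ε ψ hn hψ hflat U hU hcliff
  classical
  -- the unitary and its label map
  have hUU : Uᴴ * U = 1 := by
    have h := Matrix.mem_unitaryGroup_iff'.1 hU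
    rwa [Matrix.star_eq_conjTranspose] at h
  have hUU' : U * Uᴴ = 1 := by
    have h := Matrix.mem_unitaryGroup_iff.1 hU
    rwa [Matrix.star_eq_conjTranspose] at h
  choose f c hcf using hcliff
  have hf : ∀ S, ‖c S‖ = 1 ∧ U * pauliString S * Uᴴ = c S • pauliString (f S) := by
    intro S
    have h := hcf S
    rwa [Matrix.star_eq_conjTranspose] at h
  -- the state is a unit vector
  have hnorm : ∑ x, ‖(U *ᵥ tensorVec ψ (zeroState m)) x‖ ^ 2 = 1 := by
    have h1 : star (U *ᵥ tensorVec ψ (zeroState m)) ⬝ᵥ (U *ᵥ tensorVec ψ (zeroState m)) =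
        (((1 : ℝ)) : ℂ) := by
      rw [star_mulVec_dotProduct_mulVec hUU, star_dotProduct_self,
        normSq_tensorVec_zeroState m hψ]
    have h2 := star_dotProduct_self (U *ᵥ tensorVec ψ (zeroState m))
    rw [h1] at h2
    have h3 : (1 : ℝ) = normSq (U *ᵥ tensorVec ψ (zeroState m)) := by exact_mod_cast h2
    rw [normSq] at h3
    exact h3.symm
  -- the stabilizer counts along the chain
  set a : ℕ → ℕ := fun k =>
    ((Fintype.piFinset (fun _ : Fin m => ({Pauli.I, Pauli.Z} : Finset Pauli))).filter
      fun R => f (Fin.append (fun _ : Fin n => Pauli.I) R) ∈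
        stringsOn (Finset.univ.filter fun i : Fin (n + m) => i.val < k)).card with ha
  have hmono : ∀ k, a k ≤ a (k + 1) := fun k => card_stab_mono k
  have ha0 : a 0 = 1 := card_stab_zero hUU hUU' hf
  have haN : a (n + m) = 2 ^ m := card_stab_top
  -- the cut bound along the chain
  have hcut : ∀ k ≤ n + m,
      ‖∑ x₁ : QReg (n + m), ∑ x₂ : QReg (n + m), ∑ x₃ : QReg (n + m), ∑ x₄ : QReg (n + m),
        (if (∀ i, k ≤ i.val → x₁ i = x₂ i) ∧ (∀ i, i.val < k → x₂ i = x₃ i) ∧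
            (∀ i, k ≤ i.val → x₃ i = x₄ i) ∧ (∀ i, i.val < k → x₄ i = x₁ i)
         then (U *ᵥ tensorVec ψ (zeroState m)) x₁ * star ((U *ᵥ tensorVec ψ (zeroState m)) x₂) *
           (U *ᵥ tensorVec ψ (zeroState m)) x₃ * star ((U *ᵥ tensorVec ψ (zeroState m)) x₄)
         else 0)‖ ≤ (a k : ℝ) / 2 ^ k + ε ^ 2 * (2 ^ k / a k) := by
    intro k hk
    rw [fourFold_cut_eq k]
    have h := fourFold_le_stab hUU hUU' hf ε hψ hflat
      (Finset.univ.filter fun i : Fin (n + m) => i.val < k)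
    rw [Fin.card_filter_val_lt, min_eq_right hk] at h
    exact h
  have ha_pos : ∀ k, (0 : ℝ) < a k := fun k => by
    have : 1 ≤ a k := one_le_card_stab hUU' hf _
    exact_mod_cast this
  clear_value a
  -- case analysis on `ε`
  by_cases hbig : 1 ≤ 4 * ε
  · refine ⟨0, Nat.zero_le _, ?_⟩
    rw [fourFold_cut_zero, hnorm]
    simp only [one_pow, Complex.ofReal_one, norm_one]
    exact hbig
  have hε4 : 4 * ε < 1 := not_le.1 hbig
  by_cases hsmall : (2 : ℝ) ^ m / 2 ^ (n + m) ≤ 2 * ε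
  · -- first passage through the window `(ε, 2ε]`
    have hN : (a (n + m) : ℝ) / 2 ^ (n + m) ≤ 2 * ε := by
      rw [haN]; push_cast; exact hsmall
    obtain ⟨k, hk, hlo, hhi⟩ := exists_first_passage a hmono ha0 (n + m) ε (by linarith) hN
    refine ⟨k, hk, (hcut k hk).trans ?_⟩
    have hεpos : 0 < ε := by linarith
    have h2k : (0 : ℝ) < 2 ^ k := pow_pos two_pos _
    have hak := ha_pos k
    rw [lt_div_iff₀ h2k] at hlo
    have h3 : ε * 2 ^ k / (a k : ℝ) ≤ 1 := by
      rw [div_le_one hak]; exact hlo.le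
    have h2 : ε ^ 2 * (2 ^ k / (a k : ℝ)) ≤ ε := by
      have e : ε ^ 2 * (2 ^ k / (a k : ℝ)) = ε * (ε * 2 ^ k / a k) := by ring
      rw [e]
      calc ε * (ε * 2 ^ k / a k) ≤ ε * 1 := mul_le_mul_of_nonneg_left h3 hεpos.le
        _ = ε := mul_one ε
    linarith
  · -- impossible range: at the full cut the purity is `1` while the bound is `< 1`
    exfalso
    have hlt : 2 * ε < (2 : ℝ) ^ m / 2 ^ (n + m) := not_le.1 hsmall
    have h := hcut (n + m) le_rfl
    rw [fourFold_cut_top, hnorm, haN] at h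
    simp only [one_pow, Complex.ofReal_one, norm_one] at h
    push_cast at h
    have hn1 : (2 : ℝ) ≤ 2 ^ n := by
      calc (2 : ℝ) = 2 ^ 1 := (pow_one _).symm
        _ ≤ 2 ^ n := pow_le_pow_right₀ (by norm_num) hn
    have hpow : (2 : ℝ) ^ (n + m) = 2 ^ n * 2 ^ m := pow_add _ _ _
    have h2m : (0 : ℝ) < 2 ^ m := pow_pos two_pos _
    have h2n : (0 : ℝ) < 2 ^ n := pow_pos two_pos _
    rw [hpow] at h hlt
    have e1 : (2 : ℝ) ^ m / (2 ^ n * 2 ^ m) = (2 ^ n)⁻¹ := by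
      field_simp
    have e2 : (2 : ℝ) ^ n * 2 ^ m / 2 ^ m = 2 ^ n := mul_div_cancel_right₀ _ h2m.ne'
    rw [e1] at h hlt
    rw [e2] at h
    have hεnn : 0 ≤ ε := by
      have hX : (fun _ : Fin n => Pauli.X) ≠ fun _ => Pauli.I := by
        intro hh
        have := congrFun hh ⟨0, hn⟩
        exact absurd this (by decide)
      exact (norm_nonneg _).trans (hflat _ hX)
    have h6 : 2 * ε * 2 ^ n < (2 ^ n)⁻¹ * 2 ^ n := mul_lt_mul_of_pos_right hlt h2n
    rw [inv_mul_cancel₀ h2n.ne'] at h6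
    have h3 : ε ^ 2 * 2 ^ n ≤ ε / 2 := by nlinarith [h6, hεnn]
    have h4 : ((2 : ℝ) ^ n)⁻¹ ≤ 2⁻¹ := inv_anti₀ two_pos hn1
    linarith [h, h3, h4, hε4]


end Literature.Barriers.QuantumAdvantage
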